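import Mathlib
import Literature.NumberTheory.GaloisRepresentations.SL2WreathResidualImage
import HarnessLib

/-!
# Lines on the split quadric threefold `SL₂(K) = {det = 1} ⊂ M₂(K) ≅ K⁴` (Tao 2005, Proposition 1.3)

Topic `Literature/Combinatorics/Kakeya`.  Everything in this file is PROVED (no named fact, no
`sorry`); it formalizes the finite-field "quadric obstruction" to Wolff-axiom arguments for the
Kakeya problem in four dimensions.

T. Tao, *A new bound for finite field Besicovitch sets in four dimensions*, Pacific J. Math.
**222** (2005), no. 2, 337–363 (doi:10.2140/pjm.2005.222.337), §1, p. 338, verbatim from the printed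
journal text (the arXiv version, math/0204251, numbers the same items Definition 1, Theorem 2 and
Proposition 3, with the same mathematical content and small differences of wording):

> **Definition 1.1.** A family `L` of lines in `Fⁿ` is said to obey the *Wolff axiom* if for
> every `2 ≤ k ≤ n − 1`, every `k`-dimensional affine subspace `V ⊂ Fⁿ` contains at most
> `O(|F|^{k−1})` lines in `L`. (Here we view the field `F` as being quite large, and the family `L`
> as depending on `F`. The implied constant in the `O( )` notation may depend on `n` and `k` but
> is uniform in `F`. […])
>
> **Proposition 1.3.** Let `⟨ , ⟩ : F⁴ × F⁴ → F` be a nondegenerate symmetric quadratic form on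
> `F⁴`. Let `P` be the "unit sphere" (1–1) `P := {x ∈ F⁴ : ⟨x, x⟩ = 1}` and let `L` be the set
> of all lines of the form `{x + tv : t ∈ F}`, where `x ∈ F⁴`, `v ∈ F⁴ ∖ {0}` are such that
> `⟨x, x⟩ = 1`, `⟨v, x⟩ = 0`, and `⟨v, v⟩ = 0`. Then `L` has cardinality `|L| ∼ |F|³` and obeys
> the Wolff axiom, while `P` has cardinality `|P| ∼ |F|³` and contains all the lines in `L`.

Tao continues (p. 338): "We prove this in Section 3. A similar counterexample can be created in
`ℝ⁴` as long as one chooses the form `⟨ , ⟩` to be indefinite. The proposition does not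
contradict the Kakeya conjecture because the lines `L` do not all point in different directions
(despite obeying the Wolff axiom)."  The proof is §3 ("The counterexample", pp. 340–342).
J. Zahl's survey (Proc. ICM 2026, §4.1, eq. (4.1)) writes the same hypersurface as
`Z = {(a, b, c, d) : ad − bc = 1}`.

## What is proved: the split form, with exact counts

We take the split (hyperbolic) form `⟨x, x⟩ = det x` on `K⁴ = M₂(K)`, so that the "unit sphere" is
`Z := {X ∈ M₂(K) : det X = 1} = SL₂(K)` and the polarisation is
`⟨X, Y⟩ = det (X + Y) − det X − det Y`.  For `x = g ∈ Z` and `v = g N`: `⟨v, x⟩ = tr N` and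
`⟨v, v⟩ = 2 det N`, so Tao's conditions `⟨v, x⟩ = ⟨v, v⟩ = 0` read `tr N = det N = 0` when
`char K ≠ 2` (the standing assumption of the paper; in characteristic `2` the null-vector condition
has to be read as `det v = 0`).  The theorems below are stated directly in terms of
`N² = 0 ⟺ tr N = det N = 0` and hold in every characteristic.  Throughout, `|K| ≥ 3` is phrased as
`∃ c : K, c ≠ 0 ∧ c ≠ 1` (every infinite field; for finite `K` iff `2 < |K|`, `two_lt_card_iff`);
`q = |K|` when `K` is finite.

* `line_subset_iff`, `exists_nilpotent_of_line_subset` — for `det g = 1`: the line `{g (1 + t N)}`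
  lies in `Z` iff `N² = 0` iff `tr N = det N = 0`; every line `{P + t V} ⊂ Z` is of this form
  (`N = P⁻¹ V`).  So the lines contained in `P = Z` (`linesInZ`) are exactly Tao's family `L`
  ("`P` … contains all the lines in `L`", and conversely).
* `det_direction_eq_zero` — directions of lines in `Z` are singular matrices (null vectors of the
  form): the lines "do not all point in different directions".
* `no_affine_plane` — `Z` contains no affine 2-plane.
* `natCard_sqZero` — `#{N ∈ M₂(K) : N² = 0} = |K|²`.
* `ncard_linesThrough` — exactly `q + 1` lines of `Z` through each point of `Z`.
* `natCard_Z`, `natCard_linesInZ`, `natCard_linesInZ'` — `|Z| = q (q² − 1)` and exactly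
  `(q² − 1)(q + 1) = (q − 1)(q + 1)²` lines in `Z` (double counting of incidences; `|SL₂(𝔽_q)|` from
  `Literature.NumberTheory.GaloisRepresentations.SL2Wreath.natCard_specialLinearGroup_fin_two`):
  "`|P| ∼ |F|³`", "`|L| ∼ |F|³`" with exact constants.
* `plane_inter_Z_subset`, `no_three_lines_in_plane` — two distinct coplanar lines of `Z` cut out
  `plane ∩ Z`; hence **no affine 2-plane contains three lines of `Z`**: the Wolff axiom for
  `k = 2` with the sharp constant `2` in place of `O(|F|)`.
* `prop3_split` — the conjunction, for a finite field with `2 < |K|`.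
* `ncard_linesInZIn_hyperplane_le`, `ncard_linesInZIn_space_le` — **every affine 3-space (indeed
  every affine hyperplane `{X : tr (A X) = c}`, `A ≠ 0`) contains at most `2 (q² − 1)` lines of
  `Z`**: the Wolff axiom for `k = 3` (`O(|F|^{k−1})`, constant `2`), by double counting incidences
  in the hyperplane (`ncard_linesInZIn_mul_card_le`: at most two lines of `Z` in `H` through each
  point of `Z ∩ H`, except at the point of tangency if `H` is a tangent hyperplane,
  `eq_of_isScalar`);
  `ncard_linesInZIn_hyperplane_le_linear`, `ncard_linesInZIn_space_le_linear` — the same number is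
  at most `2q + 5`: Tao's "`O(|F|)` lines in every 3-space" (proof of Prop. 1.3, p. 342) with an
  explicit constant, from a second double count (`card_inter_hyperplane_mul_le`);
  `ncard_Z_inter_hyperplane_le` — `|Z ∩ H| ≤ q (q + 1)` for every affine hyperplane `H` (first-row
  projection), whence `ncard_linesInZIn_hyperplane_le_sharp`, `ncard_linesInZIn_space_le_sharp` —
  **at most `2 (q + 1)` lines of `Z` in any affine hyperplane or 3-space**, the sharp constant (the
  number of lines on a hyperbolic quadric surface over `𝔽_q`).
* `wolffAxiom_split` — both clauses of Definition 1.1 for `n = 4` (`k = 2`: at most `2` lines of `Z`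
  in any `plane P U V`; `k = 3`: at most `2 (q² − 1)` in any `space P U V W`).
* `not_pointInDifferentDirections`, `dir_image_linesInZ`, `natCard_nullDirections`,
  `ncard_linesInZDir`, `ncard_nullVectors`, `directions_split` — "the lines `L` do not all point in
  different directions" (p. 338, with the definitions of parallel lines / lines pointing in
  different directions of §2, p. 340), quantitatively: the directions of the lines of `Z` are
  exactly the `(q + 1)²` null directions `K V` (`V ≠ 0`, `det V = 0`), each the direction of exactly
  `q − 1` parallel lines of `Z`, and there are exactly `(q − 1)(q + 1)²` nonzero null vectors
  (Tao, p. 342: "`∼ |F|³` choices of null direction").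
* `exists_linesThrough_not_subset_plane`, `nowhere_plany` — at no point of `Z` do the lines of `L`
  through it lie in a common affine `2`-plane: the family is nowhere *plany* in the sense of
  Łaba–Rai Choudhuri–Zahl 2026 (whose planebrush bound for plany families is formalized in
  `Literature.Combinatorics.Kakeya.FiniteFieldPlanebrush`; they cite this example, §2).

## Not in this file

* General nondegenerate forms on `F⁴` (Tao states Proposition 1.3 for all of them; over a finite
  field of odd characteristic the other class has Witt index `1`): every clause is proved for an
  arbitrary nondegenerate symmetric form, with explicit non-sharp constants, in the companion file
  `Literature.Combinatorics.Kakeya.Tao2005UnitSphere` (`prop13`); the exact counts and the sharp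
  constants for both classes are in `Literature.Combinatorics.Kakeya.Tao2005UnitSphereCounts`
  (`prop13_exact`: `|P| = q³ ∓ q`, `q + 1` lines of `L` through each point) and
  `Literature.Combinatorics.Kakeya.Tao2005UnitSphereSections` (`prop13_sharp`: at most `q² + q`
  points and `2 (q + 1)` lines in every affine 3-space; `exists_translate_ncard_eq`: both
  attained).
* The equality cases for 3-spaces: a hyperplane section of the quadric carries exactly `2 (q + 1)`,
  `q + 1`, `0`, `2q` or `q − 1` lines of `Z` according to its type; only the upper bound `2 (q + 1)`
  is proved here.
* The real `δ`-tube version of the example (Zahl, §4.1).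

Design: lines, planes and 3-spaces are point sets `line P V = {P + t V}`,
`plane P U V = {P + s U + t V}`, `space P U V W = {P + r U + s V + t W}` with arbitrary (possibly
zero or dependent) `V`, `U`, `W`, and affine hyperplanes are `hyperplane A c = {X : tr (A X) = c}`;
the membership predicates `linesThrough`, `linesInZ` ask for a nonzero direction, and
`linesInZIn S`, `linesThroughIn g S` restrict them to the lines contained in a set `S`, and
`linesInZDir V` to those with direction vector `V`; the direction of a line is its difference set
`dir ℓ = {X − Y : X, Y ∈ ℓ}` (`= K V`), and `IsParallel`, `PointInDifferentDirections` transcribe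
Tao's §2.  Square-zero matrices modulo scalars are handled through the explicit transversal
`rep : Option K → M₂(K)` rather than a quotient type.

## References
* [Tao2005FiniteFieldBesicovitch4D] T. Tao, Pacific J. Math. 222 (2005), no. 2, 337–363 —
  Def. 1.1 and Prop. 1.3 (§1, p. 338), proof in §3 (pp. 340–342); arXiv:math/0204251 numbers them
  Def. 1 / Prop. 3.
* [Zahl2026KakeyaSurvey] J. Zahl, *A survey of the Kakeya conjecture, 2000–2025*, Proc. ICM 2026,
  vol. 4, 270–287 (arXiv:2512.09397) — §4.1, eq. (4.1).
-/

namespace Literature.Combinatorics.Kakeya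

namespace Tao2005Quadric

open Matrix

variable {K : Type*} [Field K]

/-- Entries of a product of `2 × 2` matrices. [folklore] -/
theorem mul_apply_two (N M : Matrix (Fin 2) (Fin 2) K) (i j : Fin 2) :
    (N * M) i j = N i 0 * M 0 j + N i 1 * M 1 j := by
  simp [Matrix.mul_apply, Fin.sum_univ_two]

/-- `det (1 + t N) = 1 + t · tr N + t² · det N` for a `2 × 2` matrix `N`. [folklore] -/
theorem det_one_add_smul (N : Matrix (Fin 2) (Fin 2) K) (t : K) :
    (1 + t • N).det = 1 + t * N.trace + t ^ 2 * N.det := by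
  simp [Matrix.det_fin_two, Matrix.trace_fin_two]
  ring

/-- A `2 × 2` matrix over a field squares to zero iff its trace and its determinant vanish
(Cayley–Hamilton). [folklore] -/
theorem mul_self_eq_zero_iff (N : Matrix (Fin 2) (Fin 2) K) :
    N * N = 0 ↔ N.trace = 0 ∧ N.det = 0 := by
  rw [Matrix.trace_fin_two, Matrix.det_fin_two]
  constructor
  · intro h
    have h00 : N 0 0 * N 0 0 + N 0 1 * N 1 0 = 0 := by
      have := congrFun (congrFun h 0) 0; rwa [mul_apply_two] at this
    have h01 : N 0 0 * N 0 1 + N 0 1 * N 1 1 = 0 := by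
      have := congrFun (congrFun h 0) 1; rwa [mul_apply_two] at this
    have h10 : N 1 0 * N 0 0 + N 1 1 * N 1 0 = 0 := by
      have := congrFun (congrFun h 1) 0; rwa [mul_apply_two] at this
    have h11 : N 1 0 * N 0 1 + N 1 1 * N 1 1 = 0 := by
      have := congrFun (congrFun h 1) 1; rwa [mul_apply_two] at this
    have hb : N 0 1 * (N 0 0 + N 1 1) = 0 := by linear_combination h01
    have hc : N 1 0 * (N 0 0 + N 1 1) = 0 := by linear_combination h10
    by_cases htr : N 0 0 + N 1 1 = 0
    · refine ⟨htr, ?_⟩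
      have hd : N 1 1 = -N 0 0 := by linear_combination htr
      rw [hd]; linear_combination -h00
    · have hb0 : N 0 1 = 0 := by
        rcases mul_eq_zero.1 hb with h' | h'
        · exact h'
        · exact absurd h' htr
      have hc0 : N 1 0 = 0 := by
        rcases mul_eq_zero.1 hc with h' | h'
        · exact h'
        · exact absurd h' htr
      have ha0 : N 0 0 = 0 := by
        have : N 0 0 * N 0 0 = 0 := by rw [hb0] at h00; linear_combination h00
        exact mul_self_eq_zero.1 this
      have hd0 : N 1 1 = 0 := by
        have : N 1 1 * N 1 1 = 0 := by rw [hc0] at h11; linear_combination h11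
        exact mul_self_eq_zero.1 this
      exact absurd (by rw [ha0, hd0, add_zero]) htr
  · rintro ⟨htr, hdet⟩
    ext i j
    rw [mul_apply_two, Matrix.zero_apply]
    fin_cases i <;> fin_cases j <;> try simp only [Fin.zero_eta, Fin.mk_one, Fin.isValue]
    · linear_combination (N 0 0) * htr - hdet
    · linear_combination (N 0 1) * htr
    · linear_combination (N 1 0) * htr
    · linear_combination (N 1 1) * htr - hdet

/-- **The lines of `Z = SL₂(K)`.** For `det g = 1` over a field with at least three elements, the
affine line `t ↦ g (1 + t N)` lies in `Z = {det = 1}` iff `N² = 0`, i.e. (`mul_self_eq_zero_iff`)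
iff `tr N = det N = 0`.  With `x = g`, `v = g N` and `⟨X, Y⟩ = det (X + Y) − det X − det Y` one has
`⟨v, x⟩ = tr N` and `⟨v, v⟩ = 2 det N`, so away from characteristic `2` these are exactly the lines
`{x + t v}`, `⟨x, x⟩ = 1`, `⟨v, x⟩ = ⟨v, v⟩ = 0` of the family `L` of Tao's Proposition 1.3 (split
form), and "`P` contains all the lines in `L`".  The hypothesis `|K| ≥ 3` is necessary: over `𝔽₂`,
`N = !![1, 1; 1, 0]` has `det (1 + N) = 1` but `N² ≠ 0`.
[cite: Tao2005FiniteFieldBesicovitch4D, Prop. 1.3 (§1, p. 338) and its proof (§3)] -/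
theorem line_subset_iff (g N : Matrix (Fin 2) (Fin 2) K) (hg : g.det = 1)
    (h3 : ∃ c : K, c ≠ 0 ∧ c ≠ 1) :
    (∀ t : K, (g * (1 + t • N)).det = 1) ↔ N * N = 0 := by
  simp only [Matrix.det_mul, hg, one_mul, det_one_add_smul, mul_self_eq_zero_iff]
  constructor
  · intro h
    obtain ⟨c, hc0, hc1⟩ := h3
    have h1 := h 1
    have h2 := h c
    have e1 : N.trace + N.det = 0 := by linear_combination h1
    have e2 : c * (N.trace + c * N.det) = 0 := by linear_combination h2
    have e3 : N.trace + c * N.det = 0 := by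
      rcases mul_eq_zero.1 e2 with h' | h'
      · exact absurd h' hc0
      · exact h'
    have e4 : (c - 1) * N.det = 0 := by linear_combination e3 - e1
    have hdet : N.det = 0 := by
      rcases mul_eq_zero.1 e4 with h' | h'
      · exact absurd (sub_eq_zero.1 h') hc1
      · exact h'
    exact ⟨by linear_combination e1 - hdet, hdet⟩
  · rintro ⟨htr, hdet⟩ t
    rw [htr, hdet]; ring

/-- The direction `g N` of a line `{g (1 + t N)} ⊂ Z` is a singular matrix: the directions of all
lines in `Z` lie on the null cone `{det = 0}` of the form (`⟨v, v⟩ = 0`) and miss every invertible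
direction — "the lines `L` do not all point in different directions".
[cite: Tao2005FiniteFieldBesicovitch4D, Prop. 1.3 and the remark following it (§1, p. 338)] -/
theorem det_direction_eq_zero (g N : Matrix (Fin 2) (Fin 2) K) (hN : N * N = 0) :
    (g * N).det = 0 := by
  rw [Matrix.det_mul, ((mul_self_eq_zero_iff N).1 hN).2, mul_zero]

/-- A line `{P + t V}` inside `Z` starts at a point of `Z`: `det P = 1`. [folklore] -/
theorem det_eq_one_of_line {P V : Matrix (Fin 2) (Fin 2) K}
    (h : ∀ t : K, (P + t • V).det = 1) : P.det = 1 := by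
  simpa using h 0

/-- Conversely, every affine line `{P + t V}` contained in `Z = {det = 1}` (`|K| ≥ 3`) is of the
form `{P (1 + t N)}` with `N = P⁻¹ V` and `N² = 0`: the lines contained in the "unit sphere" `P = Z`
all belong to Tao's family `L` (split form).
[cite: Tao2005FiniteFieldBesicovitch4D, Prop. 1.3 (§1, p. 338), proof in §3] -/
theorem exists_nilpotent_of_line_subset (P V : Matrix (Fin 2) (Fin 2) K)
    (h3 : ∃ c : K, c ≠ 0 ∧ c ≠ 1) (h : ∀ t : K, (P + t • V).det = 1) :
    ∃ N : Matrix (Fin 2) (Fin 2) K, N * N = 0 ∧ V = P * N := by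
  have hP : P.det = 1 := det_eq_one_of_line h
  have hPu : IsUnit P.det := by rw [hP]; exact isUnit_one
  refine ⟨P⁻¹ * V, ?_, ?_⟩
  · rw [← line_subset_iff P (P⁻¹ * V) hP h3]
    intro t
    rw [mul_add, mul_one, Matrix.mul_smul, ← mul_assoc, Matrix.mul_nonsing_inv P hPu, one_mul]
    exact h t
  · rw [← mul_assoc, Matrix.mul_nonsing_inv P hPu, one_mul]

/-- The `(0,0)` entry of `N M + M N` for `2 × 2` matrices. [folklore] -/
theorem anticomm_apply_zero_zero (N M : Matrix (Fin 2) (Fin 2) K) :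
    (N * M + M * N) 0 0 = 2 * (N 0 0 * M 0 0) + N 0 1 * M 1 0 + M 0 1 * N 1 0 := by
  rw [Matrix.add_apply, mul_apply_two, mul_apply_two]; ring

/-- Algebraic heart of "no affine 2-plane in `SL₂`": two isotropic vectors of the split ternary
form `a² + bc` that are orthogonal for its polarisation are parallel — all 2×2 minors vanish.
Valid in every characteristic (the squares of the minors are explicit combinations). [folklore] -/
theorem minors_eq_zero {a b c e f g : K} (h1 : a ^ 2 + b * c = 0) (h2 : e ^ 2 + f * g = 0)
    (h3 : 2 * (a * e) + b * g + f * c = 0) :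
    a * f = b * e ∧ a * g = c * e ∧ b * g = c * f := by
  have m1 : (a * f - b * e) ^ 2 = 0 := by
    linear_combination f ^ 2 * h1 + b ^ 2 * h2 - b * f * h3
  have m2 : (a * g - c * e) ^ 2 = 0 := by
    linear_combination g ^ 2 * h1 + c ^ 2 * h2 - c * g * h3
  have m3 : (b * g - c * f) ^ 2 = 0 := by
    linear_combination
      (-(4 : K) * (f * g)) * h1 + (4 * a ^ 2) * h2 + (b * g + c * f - 2 * (a * e)) * h3
  refine ⟨?_, ?_, ?_⟩
  · exact sub_eq_zero.1 ((pow_eq_zero_iff two_ne_zero).1 m1)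
  · exact sub_eq_zero.1 ((pow_eq_zero_iff two_ne_zero).1 m2)
  · exact sub_eq_zero.1 ((pow_eq_zero_iff two_ne_zero).1 m3)

/-- Entries of a `2 × 2` matrix `N` with `N² = 0`: `N₁₁ = −N₀₀` and `N₀₀² + N₀₁ N₁₀ = 0`.
[folklore] -/
theorem entries_of_mul_self_eq_zero {N : Matrix (Fin 2) (Fin 2) K} (hN : N * N = 0) :
    N 1 1 = -N 0 0 ∧ N 0 0 ^ 2 + N 0 1 * N 1 0 = 0 := by
  obtain ⟨htr, hdet⟩ := (mul_self_eq_zero_iff N).1 hN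
  rw [Matrix.trace_fin_two] at htr
  rw [Matrix.det_fin_two] at hdet
  exact ⟨by linear_combination htr, by linear_combination (N 0 0) * htr - hdet⟩

/-- Two trace-free `2 × 2` matrices whose entries `(0,0), (0,1), (1,0)` are proportional
(`l Nᵢⱼ = m Mᵢⱼ`) satisfy `l • N = m • M`. [folklore] -/
theorem smul_eq_smul_of_minors {N M : Matrix (Fin 2) (Fin 2) K}
    (hN : N 1 1 = -N 0 0) (hM : M 1 1 = -M 0 0) {l m : K}
    (h00 : l * N 0 0 = m * M 0 0) (h01 : l * N 0 1 = m * M 0 1) (h10 : l * N 1 0 = m * M 1 0) :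
    l • N = m • M := by
  ext i j
  rw [Matrix.smul_apply, Matrix.smul_apply, smul_eq_mul, smul_eq_mul]
  fin_cases i <;> fin_cases j <;> try simp only [Fin.zero_eta, Fin.mk_one, Fin.isValue]
  · exact h00
  · exact h01
  · exact h10
  · rw [hN, hM]; linear_combination -h00

/-- **`Z = SL₂(K)` contains no affine 2-plane** (`|K| ≥ 3`): if `det (P + s U + t V) = 1` for all
`s, t`, then `U` and `V` are linearly dependent (a smooth quadric threefold contains no plane; here
from `minors_eq_zero` applied to the square-zero matrices `P⁻¹ U`, `P⁻¹ V`, `P⁻¹ (U + V)`).  This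
is the step behind "at most two lines of `Z` in any affine 2-plane" (`no_three_lines_in_plane`):
`det − 1` restricted to a 2-plane is then a nonzero polynomial of degree `≤ 2`. [folklore] -/
theorem no_affine_plane (P U V : Matrix (Fin 2) (Fin 2) K) (h3 : ∃ c : K, c ≠ 0 ∧ c ≠ 1)
    (h : ∀ s t : K, (P + s • U + t • V).det = 1) :
    ∃ l m : K, (l ≠ 0 ∨ m ≠ 0) ∧ l • U = m • V := by
  have hP : P.det = 1 := by simpa using h 0 0
  have hPu : IsUnit P.det := by rw [hP]; exact isUnit_one
  -- the three lines through `P` in directions `U`, `V`, `U + V`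
  have hU : ∀ t : K, (P + t • U).det = 1 := fun t => by simpa using h t 0
  have hV : ∀ t : K, (P + t • V).det = 1 := fun t => by simpa using h 0 t
  have hUV : ∀ t : K, (P + t • (U + V)).det = 1 := fun t => by
    have := h t t; rwa [smul_add, ← add_assoc]
  -- nilpotents N = P⁻¹U, M = P⁻¹V
  set N := P⁻¹ * U with hNdef
  set M := P⁻¹ * V with hMdef
  have hUN : U = P * N := by rw [hNdef, ← mul_assoc, Matrix.mul_nonsing_inv P hPu, one_mul]
  have hVM : V = P * M := by rw [hMdef, ← mul_assoc, Matrix.mul_nonsing_inv P hPu, one_mul]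
  clear_value N M
  have key : ∀ W : Matrix (Fin 2) (Fin 2) K, (∀ t : K, (P + t • (P * W)).det = 1) → W * W = 0 := by
    intro W hW
    rw [← line_subset_iff P W hP h3]
    intro t
    rw [mul_add, mul_one, Matrix.mul_smul]
    exact hW t
  have hN : N * N = 0 := key N (by rw [← hUN]; exact hU)
  have hM : M * M = 0 := key M (by rw [← hVM]; exact hV)
  have hNM : (N + M) * (N + M) = 0 := key (N + M) (by rw [mul_add, ← hUN, ← hVM]; exact hUV)
  have hanti : N * M + M * N = 0 := by
    have : (N + M) * (N + M) = N * N + (N * M + M * N) + M * M := by noncomm_ring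
    rw [this, hN, hM, zero_add, add_zero] at hNM
    exact hNM
  obtain ⟨hN11, hN1⟩ := entries_of_mul_self_eq_zero hN
  obtain ⟨hM11, hM1⟩ := entries_of_mul_self_eq_zero hM
  have h3' : 2 * (N 0 0 * M 0 0) + N 0 1 * M 1 0 + M 0 1 * N 1 0 = 0 := by
    rw [← anticomm_apply_zero_zero, hanti, Matrix.zero_apply]
  obtain ⟨m1, m2, m3⟩ := minors_eq_zero hN1 hM1 h3'
  -- m1 : N00 * M01 = N01 * M00 ; m2 : N00 * M10 = N10 * M00 ; m3 : N01 * M10 = N10 * M01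
  by_cases ha : N 0 0 = 0
  · by_cases hb : N 0 1 = 0
    · by_cases hc : N 1 0 = 0
      · -- N = 0, hence U = 0
        refine ⟨1, 0, Or.inl one_ne_zero, ?_⟩
        have hN0 : N = 0 := by
          ext i j
          fin_cases i <;> fin_cases j <;> try simp only [Fin.zero_eta, Fin.mk_one, Fin.isValue]
          · exact ha
          · exact hb
          · exact hc
          · rw [Matrix.zero_apply, hN11, ha, neg_zero]
        rw [one_smul, zero_smul, hUN, hN0, mul_zero]
      · -- c ≠ 0 : g • N = c • M  (l = M 1 0, m = N 1 0)
        refine ⟨M 1 0, N 1 0, Or.inr hc, ?_⟩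
        rw [hUN, hVM, ← Matrix.mul_smul, ← Matrix.mul_smul]
        congr 1
        exact smul_eq_smul_of_minors (l := M 1 0) (m := N 1 0) hN11 hM11
          (by linear_combination m2) (by linear_combination m3) (by ring)
    · -- b ≠ 0 : f • N = b • M
      refine ⟨M 0 1, N 0 1, Or.inr hb, ?_⟩
      rw [hUN, hVM, ← Matrix.mul_smul, ← Matrix.mul_smul]
      congr 1
      exact smul_eq_smul_of_minors (l := M 0 1) (m := N 0 1) hN11 hM11
        (by linear_combination m1) (by ring) (by linear_combination -m3)
  · -- a ≠ 0 : e • N = a • M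
    refine ⟨M 0 0, N 0 0, Or.inr ha, ?_⟩
    rw [hUN, hVM, ← Matrix.mul_smul, ← Matrix.mul_smul]
    congr 1
    exact smul_eq_smul_of_minors (l := M 0 0) (m := N 0 0) hN11 hM11 (by ring)
      (by linear_combination -m1) (by linear_combination -m2)

/-- For a finite field, `2 < |K|` iff there is an element other than `0` and `1` — the form in
which the standing hypothesis `|K| ≥ 3` is used in this file (it holds in every infinite field).
[folklore] -/
theorem two_lt_card_iff [Fintype K] : 2 < Fintype.card K ↔ ∃ c : K, c ≠ 0 ∧ c ≠ 1 := by
  classical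
  constructor
  · intro h
    by_contra hc
    push Not at hc
    have hsub : (Finset.univ : Finset K) ⊆ {0, 1} := by
      intro x _
      by_cases hx : x = 0
      · simp [hx]
      · simp [hc x hx]
    have h2 := Finset.card_le_card hsub
    rw [Finset.card_pair (zero_ne_one : (0 : K) ≠ 1), Finset.card_univ] at h2
    omega
  · rintro ⟨c, hc0, hc1⟩
    have hnot : c ∉ ({0, 1} : Finset K) := by simp [hc0, hc1]
    have h1 := Finset.card_insert_of_notMem hnot
    have h2 := Finset.card_pair (zero_ne_one : (0 : K) ≠ 1)
    have h3 := Finset.card_le_univ ({c, 0, 1} : Finset K)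
    omega


/-! ## Counting square-zero matrices

An explicit parametrisation of the square-zero `2 × 2` matrices over a field by `K × K`, hence
`#{N : N² = 0} = |K|²` and `#{N ≠ 0 : N² = 0} = |K|² − 1` (the case `n = 2` of the classical count
`q^{n² − n}` of nilpotent `n × n` matrices over `𝔽_q`).  The lines of `Z` through `g` are the sets
`{g (1 + t N)}` with `N ≠ 0`, `N² = 0`, two such `N` giving the same line iff they are proportional
(next section). -/

section Count

variable [DecidableEq K]

/-- Parametrisation of `{N : N*N = 0}` by `K × K`:
`(a,b) ↦ [[a,b],[-a²/b,-a]]` if `b ≠ 0`, and `(a,0) ↦ [[0,0],[a,0]]`. [folklore] -/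
def sqZeroParam (p : K × K) : Matrix (Fin 2) (Fin 2) K :=
  if p.2 = 0 then !![0, 0; p.1, 0] else !![p.1, p.2; -(p.1 ^ 2 / p.2), -p.1]

/-- Inverse chart: read off `(N₀₀, N₀₁)` if `N₀₁ ≠ 0`, else `(N₁₀, 0)`. [folklore] -/
def sqZeroChart (N : Matrix (Fin 2) (Fin 2) K) : K × K :=
  if N 0 1 = 0 then (N 1 0, 0) else (N 0 0, N 0 1)

/-- Every `sqZeroParam p` squares to zero. [folklore] -/
theorem sqZeroParam_mul_self (p : K × K) : sqZeroParam p * sqZeroParam p = 0 := by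
  unfold sqZeroParam
  split_ifs with h
  · ext i j
    fin_cases i <;> fin_cases j <;> simp [Matrix.mul_apply, Fin.sum_univ_two]
  · rw [mul_self_eq_zero_iff, Matrix.trace_fin_two, Matrix.det_fin_two]
    simp only [Matrix.of_apply, Matrix.cons_val', Matrix.cons_val_zero, Matrix.cons_val_one,
      Matrix.cons_val_fin_one, Matrix.empty_val']
    constructor
    · ring
    · field_simp
      ring

/-- `sqZeroChart` is a left inverse of `sqZeroParam`. [folklore] -/
theorem sqZeroChart_param (p : K × K) : sqZeroChart (sqZeroParam p) = p := by
  obtain ⟨a, b⟩ := p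
  unfold sqZeroParam sqZeroChart
  by_cases hb : b = 0
  · subst hb
    simp
  · simp [hb]

/-- `sqZeroParam ∘ sqZeroChart` is the identity on square-zero matrices. [folklore] -/
theorem sqZeroParam_chart {N : Matrix (Fin 2) (Fin 2) K} (hN : N * N = 0) :
    sqZeroParam (sqZeroChart N) = N := by
  obtain ⟨h11, hq⟩ := entries_of_mul_self_eq_zero hN
  unfold sqZeroParam sqZeroChart
  by_cases hb : N 0 1 = 0
  · have ha : N 0 0 = 0 := by
      have : N 0 0 ^ 2 = 0 := by rw [hb, zero_mul, add_zero] at hq; exact hq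
      exact pow_eq_zero_iff two_ne_zero |>.1 this
    simp only [hb, ↓reduceIte]
    ext i j
    fin_cases i <;> fin_cases j
    · simp [ha]
    · simp [hb]
    · simp
    · simp [h11, ha]
  · simp only [hb, ↓reduceIte]
    ext i j
    fin_cases i <;> fin_cases j
    · simp
    · simp
    · simp only [Fin.mk_one, Fin.isValue, Fin.zero_eta, Matrix.of_apply, Matrix.cons_val',
        Matrix.cons_val_zero, Matrix.cons_val_one, Matrix.cons_val_fin_one, Matrix.empty_val']
      field_simp
      linear_combination -hq
    · simp [h11]

/-- `K × K ≃ {N : N² = 0}` (2×2 matrices over a field). [folklore] -/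
def sqZeroEquiv : K × K ≃ {N : Matrix (Fin 2) (Fin 2) K // N * N = 0} where
  toFun p := ⟨sqZeroParam p, sqZeroParam_mul_self p⟩
  invFun N := sqZeroChart N.1
  left_inv p := sqZeroChart_param p
  right_inv N := Subtype.ext (sqZeroParam_chart N.2)

/-- `#{N ∈ M₂(K) : N² = 0} = |K|²` (as `Nat.card`; for infinite `K` both sides are `0`).
[folklore] -/
theorem natCard_sqZero :
    Nat.card {N : Matrix (Fin 2) (Fin 2) K // N * N = 0} = Nat.card K ^ 2 := by
  rw [← Nat.card_congr (sqZeroEquiv (K := K)), Nat.card_prod, sq]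

/-- `#{N ∈ M₂(𝔽_q) : N ≠ 0, N² = 0} = q² − 1`: the number of admissible direction parameters `N`
for lines `{g(1+tN)}` through a point `g` of `Z`, before quotienting by scalars (for infinite `K`
both sides are `0`). [folklore] -/
theorem ncard_sqZero_ne_zero :
    ({N : Matrix (Fin 2) (Fin 2) K | N * N = 0} \ {0}).ncard = Nat.card K ^ 2 - 1 := by
  rw [Set.ncard_sdiff_singleton_of_mem (by simp : (0 : Matrix (Fin 2) (Fin 2) K) ∈ {N | N * N = 0}),
    ← natCard_sqZero, ← Nat.card_coe_set_eq]
  rfl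

end Count


/-! ## `q + 1` lines of `Z` through each of its points

Lines are point sets `line P V = {P + t V}`.  The nonzero square-zero matrices up to nonzero scalars
have the explicit transversal `rep : Option K → M₂(K)`, `rep (some a) = !![a, 1; -a², -a]`,
`rep none = !![0, 0; 1, 0]`; hence the lines of `Z` through `g` are exactly the `|K| + 1` distinct
sets `line g (g * rep o)` (no quotient types are needed).  In Tao's proof (§3) this is the step
"each line in `L` is generated by `∼ |F|²` such pairs `(x, v)`", made exact. -/

section Lines

/-- The affine line through `P` with direction vector `V`, as a point set (a single point when
`V = 0`). [folklore] -/
def line (P V : Matrix (Fin 2) (Fin 2) K) : Set (Matrix (Fin 2) (Fin 2) K) :=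
  Set.range fun t : K => P + t • V

/-- The split quadric threefold `Z = SL₂(K) = {X ∈ M₂(K) : det X = 1} ⊂ M₂(K) ≅ K⁴`: the "unit
sphere" `P = {x : ⟨x, x⟩ = 1}` of Tao's Proposition 1.3 for the split form `⟨x, x⟩ = det x`,
written `Z = {(a, b, c, d) : ad − bc = 1}` in Zahl's survey (§4.1, eq. (4.1)).
[cite: Tao2005FiniteFieldBesicovitch4D, Prop. 1.3 (§1, p. 338)] -/
def Z : Set (Matrix (Fin 2) (Fin 2) K) := {X | X.det = 1}

/-- The lines contained in `Z` that pass through `g`, written with base point `g`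
(legitimate by `line_eq_of_mem`). [folklore] -/
def linesThrough (g : Matrix (Fin 2) (Fin 2) K) : Set (Set (Matrix (Fin 2) (Fin 2) K)) :=
  {ℓ | ∃ V : Matrix (Fin 2) (Fin 2) K, V ≠ 0 ∧ ℓ = line g V ∧ ℓ ⊆ Z}

/-- The base point lies on the line. [folklore] -/
theorem mem_line_self (P V : Matrix (Fin 2) (Fin 2) K) : P ∈ line P V := ⟨0, by simp⟩

/-- A line may be re-based at any of its points. [folklore] -/
theorem line_eq_of_mem {P V g : Matrix (Fin 2) (Fin 2) K} (hg : g ∈ line P V) :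
    line P V = line g V := by
  obtain ⟨t₀, rfl⟩ := hg
  ext X
  constructor
  · rintro ⟨t, rfl⟩
    exact ⟨t - t₀, by dsimp only; rw [sub_smul]; abel⟩
  · rintro ⟨t, rfl⟩
    exact ⟨t₀ + t, by dsimp only; rw [add_smul]; abel⟩

/-- Rescaling the direction by a nonzero scalar does not change the line. [folklore] -/
theorem line_smul (P V : Matrix (Fin 2) (Fin 2) K) {c : K} (hc : c ≠ 0) :
    line P (c • V) = line P V := by
  ext X
  constructor
  · rintro ⟨t, rfl⟩
    exact ⟨t * c, by dsimp only; rw [mul_smul]⟩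
  · rintro ⟨t, rfl⟩
    exact ⟨t / c, by dsimp only; rw [smul_smul, div_mul_cancel₀ t hc]⟩

/-- If two lines with the same base point coincide, the directions are proportional. [folklore] -/
theorem exists_eq_smul_of_line_eq {P V W : Matrix (Fin 2) (Fin 2) K} (h : line P V = line P W) :
    ∃ t : K, W = t • V := by
  have : P + (1 : K) • W ∈ line P V := by rw [h]; exact ⟨1, rfl⟩
  obtain ⟨t, ht⟩ := this
  exact ⟨t, by simpa using ht.symm⟩

/-- The transversal of nonzero square-zero matrices modulo scalars. [folklore] -/
def rep : Option K → Matrix (Fin 2) (Fin 2) K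
  | none => !![0, 0; 1, 0]
  | some a => !![a, 1; -a ^ 2, -a]

/-- Each representative squares to zero. [folklore] -/
theorem rep_mul_self (o : Option K) : rep o * rep o = 0 := by
  cases o with
  | none => ext i j; fin_cases i <;> fin_cases j <;> simp [rep, Matrix.mul_apply, Fin.sum_univ_two]
  | some a =>
    ext i j
    fin_cases i <;> fin_cases j <;> simp [rep, Matrix.mul_apply, Fin.sum_univ_two] <;> ring

/-- Each representative is nonzero. [folklore] -/
theorem rep_ne_zero (o : Option K) : rep o ≠ 0 := by
  cases o with
  | none => intro h; have := congrFun (congrFun h 1) 0; simp [rep] at this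
  | some a => intro h; have := congrFun (congrFun h 0) 1; simp [rep] at this

/-- Every nonzero square-zero matrix is a nonzero multiple of exactly one representative
(existence part). [folklore] -/
theorem exists_rep_of_sqZero {N : Matrix (Fin 2) (Fin 2) K} (hN : N * N = 0) (h0 : N ≠ 0) :
    ∃ o : Option K, ∃ c : K, c ≠ 0 ∧ N = c • rep o := by
  obtain ⟨h11, hq⟩ := entries_of_mul_self_eq_zero hN
  by_cases hb : N 0 1 = 0
  · have ha : N 0 0 = 0 := by
      have : N 0 0 ^ 2 = 0 := by rw [hb, zero_mul, add_zero] at hq; exact hq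
      exact pow_eq_zero_iff two_ne_zero |>.1 this
    have hc : N 1 0 ≠ 0 := by
      intro hc
      apply h0
      ext i j
      fin_cases i <;> fin_cases j
      · exact ha
      · exact hb
      · exact hc
      · simp [h11, ha]
    refine ⟨none, N 1 0, hc, ?_⟩
    ext i j
    fin_cases i <;> fin_cases j <;> simp [rep, ha, hb, h11]
  · refine ⟨some (N 0 0 / N 0 1), N 0 1, hb, ?_⟩
    ext i j
    fin_cases i <;> fin_cases j
    · simp [rep, mul_div_cancel₀ _ hb]
    · simp [rep]
    · simp only [rep, Fin.mk_one, Fin.isValue, Fin.zero_eta, Matrix.smul_apply, Matrix.of_apply,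
        Matrix.cons_val', Matrix.cons_val_zero, Matrix.cons_val_one, Matrix.cons_val_fin_one,
        Matrix.empty_val', smul_eq_mul]
      field_simp
      linear_combination hq
    · simp [rep, h11, mul_div_cancel₀ _ hb]

/-- Uniqueness part: proportional representatives are equal. [folklore] -/
theorem rep_injective_smul {o o' : Option K} {t : K} (h : rep o' = t • rep o) : o = o' := by
  cases o with
  | none =>
    cases o' with
    | none => rfl
    | some b => have := congrFun (congrFun h 0) 1; simp [rep] at this
  | some a =>
    cases o' with
    | none =>
      have h01 := congrFun (congrFun h 0) 1
      have h10 := congrFun (congrFun h 1) 0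
      simp [rep] at h01 h10
      rw [← h01] at h10; simp at h10
    | some b =>
      have h01 := congrFun (congrFun h 0) 1
      have h00 := congrFun (congrFun h 0) 0
      simp [rep] at h01 h00
      rw [← h01, one_mul] at h00
      rw [h00]

/-- If `det g = 1` and `N² = 0` then `det (g (1 + t N)) = 1` for every `t` (any field).
[folklore] -/
theorem det_mul_one_add_smul {g N : Matrix (Fin 2) (Fin 2) K} (hg : g.det = 1) (hN : N * N = 0)
    (t : K) : (g * (1 + t • N)).det = 1 := by
  obtain ⟨htr, hdet⟩ := (mul_self_eq_zero_iff N).1 hN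
  rw [Matrix.det_mul, hg, one_mul, det_one_add_smul, htr, hdet]; ring

/-- The candidate lines `line g (g * rep o)` are lines of `Z` through `g` ("`P` contains all the
lines in `L`"). [cite: Tao2005FiniteFieldBesicovitch4D, Prop. 1.3 (§1, p. 338)] -/
theorem line_rep_mem {g : Matrix (Fin 2) (Fin 2) K} (hg : g.det = 1) (o : Option K) :
    line g (g * rep o) ∈ linesThrough g := by
  have hgu : IsUnit g.det := by rw [hg]; exact isUnit_one
  refine ⟨g * rep o, ?_, rfl, ?_⟩
  · intro h
    apply rep_ne_zero o
    have : g⁻¹ * (g * rep o) = 0 := by rw [h, mul_zero]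
    rwa [← mul_assoc, Matrix.nonsing_inv_mul g hgu, one_mul] at this
  · rintro X ⟨t, rfl⟩
    show (g + t • (g * rep o)).det = 1
    have : g + t • (g * rep o) = g * (1 + t • rep o) := by
      rw [mul_add, mul_one, Matrix.mul_smul]
    rw [this]
    exact det_mul_one_add_smul hg (rep_mul_self o) t

/-- **The lines of `Z` through `g` are exactly the `line g (g * rep o)`, `o : Option K`**
(`det g = 1`, `|K| ≥ 3`). [cite: Tao2005FiniteFieldBesicovitch4D, Prop. 1.3, proof (§3, p. 342)] -/
theorem linesThrough_eq {g : Matrix (Fin 2) (Fin 2) K} (hg : g.det = 1)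
    (h3 : ∃ c : K, c ≠ 0 ∧ c ≠ 1) :
    linesThrough g = Set.range fun o : Option K => line g (g * rep o) := by
  ext ℓ
  constructor
  · rintro ⟨V, hV0, rfl, hZ⟩
    have hline : ∀ t : K, (g + t • V).det = 1 := fun t => hZ ⟨t, rfl⟩
    obtain ⟨N, hN, rfl⟩ := exists_nilpotent_of_line_subset g V h3 hline
    have hN0 : N ≠ 0 := by rintro rfl; exact hV0 (mul_zero g)
    obtain ⟨o, c, hc, rfl⟩ := exists_rep_of_sqZero hN hN0
    exact ⟨o, by rw [Matrix.mul_smul, line_smul _ _ hc]⟩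
  · rintro ⟨o, rfl⟩
    exact line_rep_mem hg o

/-- Distinct representatives give distinct lines through `g`. [folklore] -/
theorem line_rep_injective {g : Matrix (Fin 2) (Fin 2) K} (hg : g.det = 1) :
    Function.Injective fun o : Option K => line g (g * rep o) := by
  have hgu : IsUnit g.det := by rw [hg]; exact isUnit_one
  intro o o' h
  obtain ⟨t, ht⟩ := exists_eq_smul_of_line_eq h
  -- ht : g * rep o' = t • (g * rep o)
  apply rep_injective_smul (t := t)
  have h' : g⁻¹ * (g * rep o') = g⁻¹ * (t • (g * rep o)) := by rw [ht]
  rwa [← mul_assoc, Matrix.nonsing_inv_mul g hgu, one_mul, Matrix.mul_smul, ← mul_assoc,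
    Matrix.nonsing_inv_mul g hgu, one_mul] at h'

/-- **Per-point count: through every point of `Z = SL₂(𝔽_q)` pass exactly `q + 1` lines contained
in `Z`** (`q ≥ 3`).  Their union is the tangent cone of `Z` at the point; compare Zahl's survey,
§4.1: "For each `x ∈ E`, there are approximately `δ⁻¹` distinct `δ` tubes that contain `x`; their
union forms the `δ`-neighbourhood of a cone with vertex `x`."
[cite: Tao2005FiniteFieldBesicovitch4D, Prop. 1.3, proof (§3, p. 342)] -/
theorem ncard_linesThrough [Finite K] {g : Matrix (Fin 2) (Fin 2) K} (hg : g.det = 1)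
    (h3 : ∃ c : K, c ≠ 0 ∧ c ≠ 1) :
    (linesThrough g).ncard = Nat.card K + 1 := by
  rw [linesThrough_eq hg h3, Set.ncard_range_of_injective (line_rep_injective hg),
    Finite.card_option]

end Lines


/-! ## The total count: `(q − 1)(q + 1)²` lines in `Z`, by double counting

Incidences `(g, ℓ)` with `g ∈ Z` and `ℓ` a line of `Z` through `g` are counted in two ways through
explicit equivalences of types, `Σ_{g ∈ Z} linesThrough g ≃ Z × Option K` and
`Σ_{ℓ ∈ linesInZ} ℓ ≃ linesInZ × K`.  With `|SL₂(𝔽_q)| = q (q² − 1)`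
(`Literature.NumberTheory.GaloisRepresentations.SL2Wreath.natCard_specialLinearGroup_fin_two`) this
gives `#linesInZ · q = q (q² − 1)(q + 1)`, i.e. `#linesInZ = (q² − 1)(q + 1) = (q − 1)(q + 1)²`:
Tao's "`|P| ∼ |F|³`" and "`|L| ∼ |F|³`" with exact constants. -/

section TotalCount

local notation "M" => Matrix (Fin 2) (Fin 2) K

/-- All affine lines (as point sets, with a nonzero direction) contained in `Z`: by
`exists_nilpotent_of_line_subset` and `line_subset_iff` this is the family `L` of Tao's
Proposition 1.3 for the split form (`char K ≠ 2`; see the module docstring).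
[cite: Tao2005FiniteFieldBesicovitch4D, Prop. 1.3 (§1, p. 338)] -/
def linesInZ : Set (Set M) :=
  {ℓ | ∃ P V : M, V ≠ 0 ∧ ℓ = line P V ∧ ℓ ⊆ Z}

/-- A line of `Z` through `g` is a line of `Z`. [folklore] -/
theorem mem_linesInZ_of_mem_linesThrough {g : M} {ℓ : Set M} (h : ℓ ∈ linesThrough g) :
    ℓ ∈ linesInZ := by
  obtain ⟨V, hV, rfl, hZ⟩ := h
  exact ⟨g, V, hV, rfl, hZ⟩

/-- A line through `g` contains `g`. [folklore] -/
theorem self_mem_of_mem_linesThrough {g : M} {ℓ : Set M} (h : ℓ ∈ linesThrough g) : g ∈ ℓ := by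
  obtain ⟨V, _, rfl, _⟩ := h
  exact mem_line_self g V

/-- If some line of `Z` passes through `g` then `g ∈ Z`. [folklore] -/
theorem mem_Z_of_mem_linesThrough {g : M} {ℓ : Set M} (h : ℓ ∈ linesThrough g) : g ∈ Z := by
  obtain ⟨V, _, rfl, hZ⟩ := h
  exact hZ (mem_line_self g V)

/-- A line of `Z` is a line of `Z` through each of its points. [folklore] -/
theorem mem_linesThrough_of_mem {g : M} {ℓ : Set M} (hℓ : ℓ ∈ linesInZ) (hg : g ∈ ℓ) :
    ℓ ∈ linesThrough g := by
  obtain ⟨P, V, hV, rfl, hZ⟩ := hℓ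
  exact ⟨V, hV, line_eq_of_mem hg, hZ⟩

/-- Points of lines of `Z` lie in `Z`. [folklore] -/
theorem mem_Z_of_mem_linesInZ {g : M} {ℓ : Set M} (hℓ : ℓ ∈ linesInZ) (hg : g ∈ ℓ) : g ∈ Z := by
  obtain ⟨P, V, _, rfl, hZ⟩ := hℓ
  exact hZ hg

/-- Membership in `Z`, unfolded: `det X = 1`. [folklore] -/
theorem det_eq_one_of_mem_Z {X : M} (h : X ∈ Z) : Matrix.det X = 1 := h

/-- The two ways of fibering the incidence set `{(g, ℓ) : g ∈ ℓ, ℓ a line of Z}`: over the points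
of `Z` and over the lines of `Z`. [folklore] -/
def incidenceEquiv :
    (Σ g : (Z : Set M), (linesThrough (g : M) : Set (Set M))) ≃
      (Σ ℓ : (linesInZ : Set (Set M)), (ℓ : Set M)) where
  toFun x := ⟨⟨x.2.1, mem_linesInZ_of_mem_linesThrough x.2.2⟩,
    ⟨x.1.1, self_mem_of_mem_linesThrough x.2.2⟩⟩
  invFun y := ⟨⟨y.2.1, mem_Z_of_mem_linesInZ y.1.2 y.2.2⟩,
    ⟨y.1.1, mem_linesThrough_of_mem y.1.2 y.2.2⟩⟩
  left_inv _ := rfl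
  right_inv _ := rfl

/-- For `g ∈ Z`: the lines of `Z` through `g` are in bijection with `Option K` (`q + 1` of them).
[folklore] -/
noncomputable def linesThroughEquiv {g : M} (hg : g.det = 1) (h3 : ∃ c : K, c ≠ 0 ∧ c ≠ 1) :
    (linesThrough g : Set (Set M)) ≃ Option K :=
  (Equiv.setCongr (linesThrough_eq hg h3)).trans
    (Equiv.ofInjective _ (line_rep_injective hg)).symm

/-- A line with nonzero direction is parametrised injectively by `K`. [folklore] -/
theorem line_injective {P V : M} (hV : V ≠ 0) : Function.Injective fun t : K => P + t • V := by
  intro t s h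
  have h' : (t - s) • V = 0 := by
    rw [sub_smul]
    exact sub_eq_zero.2 (add_left_cancel h)
  rcases smul_eq_zero.1 h' with h'' | h''
  · exact sub_eq_zero.1 h''
  · exact absurd h'' hV

/-- Every line of `Z` has exactly `|K|` points. [folklore] -/
noncomputable def lineEquiv {ℓ : Set M} (h : ℓ ∈ linesInZ) : (ℓ : Set M) ≃ K :=
  (Equiv.setCongr h.choose_spec.choose_spec.2.1).trans
    (Equiv.ofInjective _ (line_injective (P := h.choose) h.choose_spec.choose_spec.1)).symm

/-- The incidence set fibred over the points of `Z` has `|Z| · (|K| + 1)` elements. [folklore] -/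
theorem natCard_incidence_left [Finite K] (h3 : ∃ c : K, c ≠ 0 ∧ c ≠ 1) :
    Nat.card (Σ g : (Z : Set M), (linesThrough (g : M) : Set (Set M))) =
      Nat.card (Z : Set M) * (Nat.card K + 1) := by
  have e : (Σ g : (Z : Set M), (linesThrough (g : M) : Set (Set M))) ≃
      Prod (↥(Z : Set M)) (Option K) :=
    (Equiv.sigmaCongrRight fun g => linesThroughEquiv (det_eq_one_of_mem_Z g.2) h3).trans
      (Equiv.sigmaEquivProd _ _)
  rw [Nat.card_congr e, Nat.card_prod, Finite.card_option]

/-- The incidence set fibred over the lines of `Z` has `#linesInZ · |K|` elements. [folklore] -/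
theorem natCard_incidence_right :
    Nat.card (Σ ℓ : (linesInZ : Set (Set M)), (ℓ : Set M)) =
      Nat.card (linesInZ : Set (Set M)) * Nat.card K := by
  have e : (Σ ℓ : (linesInZ : Set (Set M)), (ℓ : Set M)) ≃
      Prod (↥(linesInZ : Set (Set M))) K :=
    (Equiv.sigmaCongrRight fun ℓ => lineEquiv ℓ.2).trans (Equiv.sigmaEquivProd _ _)
  rw [Nat.card_congr e, Nat.card_prod]

/-- **Double count:** `#linesInZ · |K| = |Z| · (|K| + 1)` (finite `K`, `|K| ≥ 3`). [folklore] -/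
theorem natCard_linesInZ_mul [Finite K] (h3 : ∃ c : K, c ≠ 0 ∧ c ≠ 1) :
    Nat.card (linesInZ : Set (Set M)) * Nat.card K = Nat.card (Z : Set M) * (Nat.card K + 1) := by
  rw [← natCard_incidence_right, ← natCard_incidence_left h3, Nat.card_congr incidenceEquiv]

/-- `Z` *is* `SL₂(K)` as a subtype. [folklore] -/
def zEquivSL : (Z : Set M) ≃ Matrix.SpecialLinearGroup (Fin 2) K where
  toFun X := ⟨X.1, X.2⟩
  invFun A := ⟨A.1, A.2⟩
  left_inv _ := rfl
  right_inv _ := rfl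

/-- **Total count: `Z = SL₂(𝔽_q)` contains exactly `(q² − 1)(q + 1)` affine lines** (`q ≥ 3`;
uses `|SL₂(𝔽_q)| = q (q² − 1)` from the tree).  This is "`|L| ∼ |F|³`" of Tao's Proposition 1.3
(split form) with the exact constant.
[cite: Tao2005FiniteFieldBesicovitch4D, Prop. 1.3 (§1, p. 338), proof in §3] -/
theorem natCard_linesInZ [Fintype K] [DecidableEq K] (h3 : ∃ c : K, c ≠ 0 ∧ c ≠ 1) :
    Nat.card (linesInZ : Set (Set M)) = (Fintype.card K ^ 2 - 1) * (Fintype.card K + 1) := by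
  have hq : 0 < Fintype.card K := Fintype.card_pos
  have h := natCard_linesInZ_mul (K := K) h3
  rw [Nat.card_congr (zEquivSL (K := K)),
    Literature.NumberTheory.GaloisRepresentations.SL2Wreath.natCard_specialLinearGroup_fin_two,
    Nat.card_eq_fintype_card (α := K)] at h
  -- h : #L * q = q * (q² - 1) * (q + 1)
  have h' : Fintype.card K * Nat.card (linesInZ : Set (Set M)) =
      Fintype.card K * ((Fintype.card K ^ 2 - 1) * (Fintype.card K + 1)) := by
    rw [mul_comm (Fintype.card K) (Nat.card _), h]; ring
  exact Nat.eq_of_mul_eq_mul_left hq h'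

/-- The total count in factored form: exactly `(q − 1)(q + 1)²` lines in `Z = SL₂(𝔽_q)` (`q ≥ 3`).
[cite: Tao2005FiniteFieldBesicovitch4D, Prop. 1.3 (§1, p. 338)] -/
theorem natCard_linesInZ' [Fintype K] [DecidableEq K] (h3 : ∃ c : K, c ≠ 0 ∧ c ≠ 1) :
    Nat.card (linesInZ : Set (Set M)) = (Fintype.card K - 1) * (Fintype.card K + 1) ^ 2 := by
  rw [natCard_linesInZ h3]
  obtain ⟨m, hm⟩ : ∃ m, Fintype.card K = m + 1 :=
    ⟨Fintype.card K - 1, (Nat.succ_pred_eq_of_pos Fintype.card_pos).symm⟩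
  rw [hm]
  have : (m + 1) ^ 2 - 1 = m * (m + 2) := by
    rw [show (m + 1) ^ 2 = m * (m + 2) + 1 by ring, Nat.add_sub_cancel]
  rw [this, Nat.add_sub_cancel]
  ring

end TotalCount


/-! ## The Wolff axiom for `k = 2`: no affine 2-plane contains three lines of `Z`

Two distinct coplanar lines `ℓ₁, ℓ₂ ⊂ Z` already cut out `plane ∩ Z`.
Concurrent case (`ℓᵢ = line g (g Nᵢ)`): `det (g + s g N₁ + t g N₂) = 1 + s t · det (N₁ + N₂)`.
Parallel case (`ℓ₁ = line g₁ (g₁ N)`, `ℓ₂ = line (g₁ (1 + F)) (g₁ N)`):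
`det = 1 + s · tr F + s² · det F` with `tr F + det F = 0`.  The leading coefficient is nonzero by
`no_affine_plane`, so `plane ∩ Z = ℓ₁ ∪ ℓ₂`, and a third line (it has `≥ 3` points as `|K| ≥ 3`)
would share two points with `ℓ₁` or `ℓ₂`, hence coincide with it.  Tao (§3) verifies the Wolff
axiom by counting generating pairs `(x, v)` inside a 3-space; the statement proved here is the
sharp `k = 2` form: at most two lines of `L` in any affine 2-plane. -/

section Plane

local notation "M" => Matrix (Fin 2) (Fin 2) K

/-- The affine plane through `P` spanned by `U, V`, as a point set (a line or a point when `U, V`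
are linearly dependent). [folklore] -/
def plane (P U V : M) : Set M := {X | ∃ s t : K, X = P + s • U + t • V}

/-- `det (1 + Y) = 1 + tr Y + det Y` for a `2 × 2` matrix `Y`. [folklore] -/
theorem det_one_add' (Y : M) : (1 + Y).det = 1 + Y.trace + Y.det := by
  have h := det_one_add_smul Y 1
  simp only [one_smul, one_mul, one_pow] at h
  exact h

/-- `det (s A + t B)` as a binary quadratic form in `(s, t)` (`2 × 2` matrices). [folklore] -/
theorem det_smul_add_smul (A B : M) (s t : K) :
    (s • A + t • B).det =
      s ^ 2 * A.det + t ^ 2 * B.det + s * t * ((A + B).det - A.det - B.det) := by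
  simp only [Matrix.det_fin_two, Matrix.add_apply, Matrix.smul_apply, smul_eq_mul]; ring

/-- Linearity of the trace on `s A + t B`. [folklore] -/
theorem trace_smul_add_smul (A B : M) (s t : K) :
    (s • A + t • B).trace = s * A.trace + t * B.trace := by
  simp only [Matrix.trace_fin_two, Matrix.add_apply, Matrix.smul_apply, smul_eq_mul]; ring

/-- `det` on the plane spanned by two concurrent lines `line g (g N₁)`, `line g (g N₂)` of `Z`:
`1 + s t · det (N₁ + N₂)`. [folklore] -/
theorem det_concurrent {g N₁ N₂ : M} (hg : g.det = 1) (h1 : N₁ * N₁ = 0) (h2 : N₂ * N₂ = 0)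
    (s t : K) : (g + s • (g * N₁) + t • (g * N₂)).det = 1 + s * t * (N₁ + N₂).det := by
  have e : g + s • (g * N₁) + t • (g * N₂) = g * (1 + (s • N₁ + t • N₂)) := by
    rw [mul_add, mul_one, mul_add, Matrix.mul_smul, Matrix.mul_smul, add_assoc]
  obtain ⟨tr1, d1⟩ := (mul_self_eq_zero_iff N₁).1 h1
  obtain ⟨tr2, d2⟩ := (mul_self_eq_zero_iff N₂).1 h2
  rw [e, Matrix.det_mul, hg, one_mul, det_one_add', trace_smul_add_smul, det_smul_add_smul,
    tr1, tr2, d1, d2]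
  ring

/-- `det` on the plane through two parallel lines of `Z` (direction `g N`, offset `g F` with
`det (F + N) = det F`): `1 + s · tr F + s² · det F`. [folklore] -/
theorem det_parallel {g F N : M} (hg : g.det = 1) (hN : N * N = 0) (hFN : (F + N).det = F.det)
    (s t : K) : (g + s • (g * F) + t • (g * N)).det = 1 + s * F.trace + s ^ 2 * F.det := by
  have e : g + s • (g * F) + t • (g * N) = g * (1 + (s • F + t • N)) := by
    rw [mul_add, mul_one, mul_add, Matrix.mul_smul, Matrix.mul_smul, add_assoc]
  obtain ⟨trN, dN⟩ := (mul_self_eq_zero_iff N).1 hN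
  rw [e, Matrix.det_mul, hg, one_mul, det_one_add', trace_smul_add_smul, det_smul_add_smul,
    trN, dN, hFN]
  ring

/-- A plane may be re-based at any of its points. [folklore] -/
theorem plane_eq_of_mem {P U V g : M} (hg : g ∈ plane P U V) : plane P U V = plane g U V := by
  obtain ⟨s₀, t₀, rfl⟩ := hg
  ext X
  constructor
  · rintro ⟨s, t, rfl⟩
    exact ⟨s - s₀, t - t₀, by rw [sub_smul, sub_smul]; abel⟩
  · rintro ⟨s, t, rfl⟩
    exact ⟨s₀ + s, t₀ + t, by rw [add_smul, add_smul]; abel⟩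

/-- Differences of points of `plane g U V` from `g` lie in the span. [folklore] -/
theorem coords_of_mem {g U V X : M} (h : g + X ∈ plane g U V) : ∃ a b : K, X = a • U + b • V := by
  obtain ⟨a, b, hab⟩ := h
  exact ⟨a, b, by rw [add_assoc] at hab; exact add_left_cancel hab⟩

/-- Change of basis inside the span: if `W₁ = aU+bV`, `W₂ = cU+dV` are not parallel
(and `W₁ ≠ 0`), every `σU + τV` is a combination of `W₁, W₂` (no independence of `U, V` needed).
[folklore] -/
theorem span_swap {U V W₁ W₂ : M}
    {a b c d : K} (h1 : W₁ = a • U + b • V) (h2 : W₂ = c • U + d • V) (hW₁ : W₁ ≠ 0)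
    (hnp : ∀ k : K, W₂ ≠ k • W₁) (σ τ : K) : ∃ s t : K, σ • U + τ • V = s • W₁ + t • W₂ := by
  have hD : a * d - b * c ≠ 0 := by
    intro hD
    -- d•W₁ - b•W₂ = (ad-bc)•U = 0
    have hrel : d • W₁ = b • W₂ := by
      rw [h1, h2, smul_add, smul_add, smul_smul, smul_smul, smul_smul, smul_smul]
      have : d * a = b * c := by linear_combination hD
      rw [this, mul_comm d b]
    by_cases hb : b = 0
    · by_cases hd : d = 0
      · -- W₁ = aU, W₂ = cU, a ≠ 0
        have ha : a ≠ 0 := by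
          rintro rfl; apply hW₁; rw [h1, hb, zero_smul, zero_smul, add_zero]
        apply hnp (c / a)
        rw [h1, h2]
        simp only [hb, hd, zero_smul, add_zero]
        rw [smul_smul, div_mul_cancel₀ c ha]
      · -- b = 0, d ≠ 0: d•W₁ = 0
        rw [hb, zero_smul] at hrel
        exact hW₁ ((smul_eq_zero.1 hrel).resolve_left hd)
    · apply hnp (d / b)
      calc W₂ = b⁻¹ • (b • W₂) := by rw [smul_smul, inv_mul_cancel₀ hb, one_smul]
        _ = b⁻¹ • (d • W₁) := by rw [hrel]
        _ = (d / b) • W₁ := by rw [smul_smul, div_eq_inv_mul]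
  refine ⟨(σ * d - τ * c) / (a * d - b * c), (τ * a - σ * b) / (a * d - b * c), ?_⟩
  have hsa : (σ * d - τ * c) / (a * d - b * c) * a + (τ * a - σ * b) / (a * d - b * c) * c = σ := by
    rw [div_mul_eq_mul_div, div_mul_eq_mul_div, ← add_div, div_eq_iff hD]; ring
  have hsb : (σ * d - τ * c) / (a * d - b * c) * b + (τ * a - σ * b) / (a * d - b * c) * d = τ := by
    rw [div_mul_eq_mul_div, div_mul_eq_mul_div, ← add_div, div_eq_iff hD]; ring
  set s := (σ * d - τ * c) / (a * d - b * c)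
  set t := (τ * a - σ * b) / (a * d - b * c)
  calc σ • U + τ • V = (s * a + t * c) • U + (s * b + t * d) • V := by rw [hsa, hsb]
    _ = s • W₁ + t • W₂ := by rw [h1, h2, add_smul, add_smul, mul_smul, mul_smul, mul_smul,
        mul_smul, smul_add, smul_add]; abel

/-- Two points determine a line: if two distinct points of `line g W` lie on `line h W'`,
the lines coincide. [folklore] -/
theorem line_eq_of_two_mem {g W h W' x y : M} (hW : W ≠ 0) (hxy : x ≠ y)
    (hx : x ∈ line g W) (hy : y ∈ line g W) (hx' : x ∈ line h W') (hy' : y ∈ line h W') :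
    line g W = line h W' := by
  rw [line_eq_of_mem hx, line_eq_of_mem hx']
  rw [line_eq_of_mem hx] at hy
  rw [line_eq_of_mem hx'] at hy'
  obtain ⟨a, rfl⟩ := hy
  obtain ⟨b, hb⟩ := hy'
  -- x + a•W = x + b•W', a ≠ 0, b ≠ 0
  have ha : a ≠ 0 := by rintro rfl; apply hxy; simp
  have hab : a • W = b • W' := add_left_cancel hb.symm
  have hb0 : b ≠ 0 := by
    rintro rfl; rw [zero_smul] at hab; exact ha ((smul_eq_zero.1 hab).resolve_right hW)
  have : W' = (a / b) • W := by
    rw [div_eq_mul_inv, mul_comm, mul_smul, hab, smul_smul, inv_mul_cancel₀ hb0, one_smul]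
  rw [this, line_smul _ _ (div_ne_zero ha hb0)]

/-- **Two distinct coplanar lines of `Z` cut out `plane ∩ Z`.**  (No independence hypothesis on
`U, V` is needed: for dependent `U, V` the set `plane P U V` is a line or a point and cannot contain
two distinct lines, so the statement is vacuous.) [folklore] -/
theorem plane_inter_Z_subset {P U V : M}
    (h3 : ∃ c : K, c ≠ 0 ∧ c ≠ 1) {ℓ₁ ℓ₂ : Set M} (hℓ₁ : ℓ₁ ∈ linesInZ) (hℓ₂ : ℓ₂ ∈ linesInZ)
    (hne : ℓ₁ ≠ ℓ₂) (hA₁ : ℓ₁ ⊆ plane P U V) (hA₂ : ℓ₂ ⊆ plane P U V) :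
    plane P U V ∩ Z ⊆ ℓ₁ ∪ ℓ₂ := by
  obtain ⟨g₁, W₁, hW₁, rfl, hZ₁⟩ := hℓ₁
  obtain ⟨g₂, W₂, hW₂, rfl, hZ₂⟩ := hℓ₂
  -- re-base the plane at g₁
  have hg₁A : g₁ ∈ plane P U V := hA₁ (mem_line_self g₁ W₁)
  rw [plane_eq_of_mem hg₁A] at hA₁ hA₂ ⊢
  -- coordinates
  obtain ⟨a, b, hW₁ab⟩ := coords_of_mem (hA₁ (show g₁ + W₁ ∈ line g₁ W₁ from ⟨1, by simp⟩))
  have hg₂A : g₂ ∈ plane g₁ U V := hA₂ (mem_line_self g₂ W₂)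
  obtain ⟨c, d, hW₂cd⟩ : ∃ c d : K, W₂ = c • U + d • V := by
    obtain ⟨p, q, hpq⟩ := hg₂A
    obtain ⟨p', q', hpq'⟩ := hA₂ (show g₂ + W₂ ∈ line g₂ W₂ from ⟨1, by simp⟩)
    refine ⟨p' - p, q' - q, ?_⟩
    have : W₂ = (g₂ + W₂) - g₂ := by abel
    rw [this, hpq', hpq, sub_smul, sub_smul]; abel
  have hdet₁ : g₁.det = 1 := hZ₁ (mem_line_self g₁ W₁)
  have hdet₂ : g₂.det = 1 := hZ₂ (mem_line_self g₂ W₂)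
  have hline₁ : ∀ t : K, (g₁ + t • W₁).det = 1 := fun t => hZ₁ ⟨t, rfl⟩
  have hline₂ : ∀ t : K, (g₂ + t • W₂).det = 1 := fun t => hZ₂ ⟨t, rfl⟩
  obtain ⟨N₁, hN₁, hW₁N⟩ := exists_nilpotent_of_line_subset g₁ W₁ h3 hline₁
  have hg₁u : IsUnit g₁.det := by rw [hdet₁]; exact isUnit_one
  by_cases hpar : ∃ k : K, W₂ = k • W₁
  · -- parallel case
    obtain ⟨k, hk⟩ := hpar
    have hk0 : k ≠ 0 := by rintro rfl; rw [zero_smul] at hk; exact hW₂ hk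
    -- E := g₂ - g₁ = e•U + f•V
    obtain ⟨e, f, hEef⟩ : ∃ e f : K, g₂ - g₁ = e • U + f • V := by
      obtain ⟨p, q, hpq⟩ := hg₂A
      exact ⟨p, q, by rw [hpq]; abel⟩
    set E := g₂ - g₁ with hEdef
    have hg₂E : g₂ = g₁ + E := by rw [hEdef]; abel
    -- E not parallel to W₁ (else the lines coincide)
    have hEnp : ∀ m : K, E ≠ m • W₁ := by
      intro m hm
      apply hne
      -- g₂ = g₁ + m W₁ ∈ line g₁ W₁, and W₂ = k W₁
      have hg₂mem : g₂ ∈ line g₁ W₁ := ⟨m, by rw [hg₂E, hm]⟩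
      rw [hk, line_smul _ _ hk0, ← line_eq_of_mem hg₂mem]
    have hE0 : E ≠ 0 := by intro h0; exact hEnp 0 (by rw [h0, zero_smul])
    -- F := g₁⁻¹ E ; relations from ℓ₂ ⊆ Z
    set F := g₁⁻¹ * E with hFdef
    have hEF : E = g₁ * F := by rw [hFdef, ← mul_assoc, Matrix.mul_nonsing_inv g₁ hg₁u, one_mul]
    have key : ∀ t : K, (1 + F + t • N₁).det = 1 := by
      intro t
      have h := hline₂ (t / k)
      have e : g₂ + (t / k) • W₂ = g₁ * (1 + F + t • N₁) := by
        rw [hg₂E, hk, smul_smul, div_mul_cancel₀ t hk0, hEF, hW₁N, mul_add, mul_add, mul_one,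
          Matrix.mul_smul]
      rw [e, Matrix.det_mul, hdet₁, one_mul] at h
      exact h
    obtain ⟨trN, dN⟩ := (mul_self_eq_zero_iff N₁).1 hN₁
    have r0 : F.trace + F.det = 0 := by
      have h := key 0
      rw [zero_smul, add_zero, det_one_add'] at h
      linear_combination h
    have r1 : (F + N₁).det = F.det := by
      have h := key 1
      rw [one_smul, add_assoc, det_one_add', Matrix.trace_add, trN, add_zero] at h
      linear_combination h - r0
    -- det F ≠ 0, else the plane lies in Z
    have hdF : F.det ≠ 0 := by
      intro hdF
      have htF : F.trace = 0 := by rw [hdF, add_zero] at r0; exact r0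
      have hall : ∀ s t : K, (g₁ + s • E + t • W₁).det = 1 := by
        intro s t
        rw [hEF, hW₁N, det_parallel hdet₁ hN₁ r1, htF, hdF]; ring
      obtain ⟨l, m, hlm, hrel⟩ := no_affine_plane g₁ E W₁ h3 hall
      rcases hlm with hl | hm
      · exact hEnp (m / l) (by rw [div_eq_mul_inv, mul_comm, mul_smul, ← hrel, smul_smul,
          inv_mul_cancel₀ hl, one_smul])
      · apply hW₁
        by_cases hl : l = 0
        · rw [hl, zero_smul] at hrel; exact (smul_eq_zero.1 hrel.symm).resolve_left hm
        · exfalso; exact hEnp (m / l) (by rw [div_eq_mul_inv, mul_comm, mul_smul, ← hrel,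
            smul_smul, inv_mul_cancel₀ hl, one_smul])
    -- now classify points of plane ∩ Z
    have hEnp' : ∀ m : K, W₁ ≠ m • E := by
      intro m hm
      have hm0 : m ≠ 0 := by rintro rfl; rw [zero_smul] at hm; exact hW₁ hm
      exact hEnp m⁻¹ (by rw [hm, smul_smul, inv_mul_cancel₀ hm0, one_smul])
    rintro X ⟨hXA, hXZ⟩
    obtain ⟨σ, τ, rfl⟩ := hXA
    obtain ⟨s, t, hst⟩ := span_swap hEef hW₁ab hE0 hEnp' σ τ
    have hX : g₁ + σ • U + τ • V = g₁ + s • E + t • W₁ := by rw [add_assoc, hst, ← add_assoc]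
    rw [hX] at hXZ ⊢
    have hdetX : (g₁ + s • E + t • W₁).det = 1 + s * F.trace + s ^ 2 * F.det := by
      rw [hEF, hW₁N, det_parallel hdet₁ hN₁ r1]
    have hX1 : (g₁ + s • E + t • W₁).det = 1 := hXZ
    have htr : F.trace = -F.det := by linear_combination r0
    rw [hX1, htr] at hdetX
    have hs : s * (s - 1) * F.det = 0 := by linear_combination -hdetX
    rcases mul_eq_zero.1 hs with hs' | hs'
    · rcases mul_eq_zero.1 hs' with h0 | h1
      · left; exact ⟨t, by dsimp only; rw [h0, zero_smul, add_zero]⟩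
      · right
        have hs1 : s = 1 := by linear_combination h1
        refine ⟨t / k, ?_⟩
        dsimp only
        rw [hk, smul_smul, div_mul_cancel₀ t hk0, hg₂E, hs1, one_smul]
    · exact absurd hs' hdF
  · -- concurrent case
    simp only [not_exists] at hpar
    -- find the common point g = g₂ - β W₂ = g₁ + α W₁
    obtain ⟨e, f, hEef⟩ : ∃ e f : K, g₂ - g₁ = e • U + f • V := by
      obtain ⟨p, q, hpq⟩ := hg₂A
      exact ⟨p, q, by rw [hpq]; abel⟩
    obtain ⟨α, β, hαβ⟩ := span_swap hW₁ab hW₂cd hW₁ hpar e f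
    set g := g₁ + α • W₁ with hgdef
    have hg₂g : g₂ = g + β • W₂ := by
      have : g₂ = g₁ + (g₂ - g₁) := by abel
      rw [this, hEef, hαβ, hgdef]; abel
    have hgℓ₁ : g ∈ line g₁ W₁ := ⟨α, rfl⟩
    have hgℓ₂ : g ∈ line g₂ W₂ := ⟨-β, by dsimp only; rw [hg₂g, neg_smul]; abel⟩
    have hL₁ : line g₁ W₁ = line g W₁ := line_eq_of_mem hgℓ₁
    have hL₂ : line g₂ W₂ = line g W₂ := line_eq_of_mem hgℓ₂
    have hdetg : g.det = 1 := hZ₁ hgℓ₁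
    have hgu : IsUnit g.det := by rw [hdetg]; exact isUnit_one
    have hl₁ : ∀ t : K, (g + t • W₁).det = 1 := fun t => hZ₁ (by rw [hL₁]; exact ⟨t, rfl⟩)
    have hl₂ : ∀ t : K, (g + t • W₂).det = 1 := fun t => hZ₂ (by rw [hL₂]; exact ⟨t, rfl⟩)
    obtain ⟨M₁, hM₁, hW₁M⟩ := exists_nilpotent_of_line_subset g W₁ h3 hl₁
    obtain ⟨M₂, hM₂, hW₂M⟩ := exists_nilpotent_of_line_subset g W₂ h3 hl₂
    -- det (M₁ + M₂) ≠ 0, else the plane lies in Z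
    have hD : (M₁ + M₂).det ≠ 0 := by
      intro hD
      have hall : ∀ s t : K, (g + s • W₁ + t • W₂).det = 1 := by
        intro s t; rw [hW₁M, hW₂M, det_concurrent hdetg hM₁ hM₂, hD]; ring
      obtain ⟨l, m, hlm, hrel⟩ := no_affine_plane g W₁ W₂ h3 hall
      rcases hlm with hl | hm
      · -- W₁ = (m/l) W₂ → W₂ parallel W₁ unless ...
        by_cases hm : m = 0
        · rw [hm, zero_smul] at hrel; exact hW₁ ((smul_eq_zero.1 hrel).resolve_left hl)
        · exact hpar (l / m) (by rw [div_eq_mul_inv, mul_comm, mul_smul, hrel, smul_smul,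
            inv_mul_cancel₀ hm, one_smul])
      · exact hpar (l / m) (by rw [div_eq_mul_inv, mul_comm, mul_smul, hrel, smul_smul,
          inv_mul_cancel₀ hm, one_smul])
    -- classify points: re-base plane at g
    have hgA : g ∈ plane g₁ U V := hA₁ hgℓ₁
    rw [plane_eq_of_mem hgA]
    rintro X ⟨hXA, hXZ⟩
    obtain ⟨σ, τ, rfl⟩ := hXA
    obtain ⟨s, t, hst⟩ := span_swap hW₁ab hW₂cd hW₁ hpar σ τ
    have hX : g + σ • U + τ • V = g + s • W₁ + t • W₂ := by rw [add_assoc, hst, ← add_assoc]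
    rw [hX] at hXZ ⊢
    have hX1 : (g + s • W₁ + t • W₂).det = 1 := hXZ
    rw [hW₁M, hW₂M, det_concurrent hdetg hM₁ hM₂] at hX1
    have hst0 : s * t * (M₁ + M₂).det = 0 := by linear_combination hX1
    rcases mul_eq_zero.1 hst0 with h' | h'
    · rcases mul_eq_zero.1 h' with hs | ht
      · right; rw [hL₂]; exact ⟨t, by dsimp only; rw [hs, zero_smul, add_zero]⟩
      · left; rw [hL₁]; exact ⟨s, by dsimp only; rw [ht, zero_smul, add_zero]⟩
    · exact absurd h' hD

/-- **The Wolff axiom, `k = 2`, sharp form: no affine 2-plane `{P + s U + t V}` contains three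
distinct lines of `Z`** (`|K| ≥ 3`; true for every `P, U, V`, degenerate spans included).  Tao's
Definition 1.1 asks for at most `O(|F|^{k−1})` lines of `L` in every affine `k`-space (`k = 2, 3`
in `F⁴`); "at most two lines in any 2-plane" is the case `k = 2` with an absolute constant; the
case `k = 3` (at most `2 (q² − 1)`, indeed at most `2q + 5`, lines of `Z` in any affine 3-space) is
`ncard_linesInZIn_space_le` / `ncard_linesInZIn_space_le_linear` in section `ThreeSpace` below
(Tao's proof, p. 342, bounds the lines of `L` in any affine 3-space by `O(|F|)`).
[cite: Tao2005FiniteFieldBesicovitch4D, Prop. 1.3 (§1, p. 338: "obeys the Wolff axiom"), Def. 1.1,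
§3 (p. 342)] -/
theorem no_three_lines_in_plane {P U V : M}
    (h3 : ∃ c : K, c ≠ 0 ∧ c ≠ 1) {ℓ₁ ℓ₂ ℓ₃ : Set M} (hℓ₁ : ℓ₁ ∈ linesInZ) (hℓ₂ : ℓ₂ ∈ linesInZ)
    (hℓ₃ : ℓ₃ ∈ linesInZ) (hA₁ : ℓ₁ ⊆ plane P U V) (hA₂ : ℓ₂ ⊆ plane P U V) (hA₃ : ℓ₃ ⊆ plane P U V)
    (h12 : ℓ₁ ≠ ℓ₂) : ℓ₃ = ℓ₁ ∨ ℓ₃ = ℓ₂ := by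
  have hsub : ℓ₃ ⊆ ℓ₁ ∪ ℓ₂ := by
    intro x hx
    obtain ⟨P₃, V₃, hV₃, rfl, hZ₃⟩ := hℓ₃
    exact plane_inter_Z_subset h3 hℓ₁ hℓ₂ h12 hA₁ hA₂ ⟨hA₃ hx, hZ₃ hx⟩
  obtain ⟨P₃, V₃, hV₃, rfl, hZ₃⟩ := hℓ₃
  obtain ⟨g₁, W₁, hW₁, rfl, -⟩ := hℓ₁
  obtain ⟨g₂, W₂, hW₂, rfl, -⟩ := hℓ₂
  -- three distinct points of ℓ₃: parameters 0, 1, c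
  obtain ⟨c, hc0, hc1⟩ := h3
  have inj := line_injective (P := P₃) hV₃
  have p0 : P₃ + (0:K) • V₃ ∈ line P₃ V₃ := ⟨0, rfl⟩
  have p1 : P₃ + (1:K) • V₃ ∈ line P₃ V₃ := ⟨1, rfl⟩
  have pc : P₃ + c • V₃ ∈ line P₃ V₃ := ⟨c, rfl⟩
  have d01 : P₃ + (0:K) • V₃ ≠ P₃ + (1:K) • V₃ := fun h => zero_ne_one (inj h)
  have d0c : P₃ + (0:K) • V₃ ≠ P₃ + c • V₃ := fun h => hc0 (inj h).symm
  have d1c : P₃ + (1:K) • V₃ ≠ P₃ + c • V₃ := fun h => hc1 (inj h).symm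
  -- pigeonhole: two of them in ℓ₁ or two in ℓ₂
  rcases hsub p0 with h0 | h0 <;> rcases hsub p1 with h1 | h1
  · left; exact line_eq_of_two_mem hV₃ d01 p0 p1 h0 h1
  · rcases hsub pc with h2 | h2
    · left; exact line_eq_of_two_mem hV₃ d0c p0 pc h0 h2
    · right; exact line_eq_of_two_mem hV₃ d1c p1 pc h1 h2
  · rcases hsub pc with h2 | h2
    · left; exact line_eq_of_two_mem hV₃ d1c p1 pc h1 h2
    · right; exact line_eq_of_two_mem hV₃ d0c p0 pc h0 h2
  · right; exact line_eq_of_two_mem hV₃ d01 p0 p1 h0 h1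

end Plane


/-! ## Proposition 1.3 (split form), assembled -/

section Assembly

local notation "M" => Matrix (Fin 2) (Fin 2) K

/-- `|Z| = |SL₂(𝔽_q)| = q (q² − 1)`: Tao's "`|P| ∼ |F|³`" for the split form, exactly (the count of
`SL₂(𝔽_q)` is the tree's `SL2Wreath.natCard_specialLinearGroup_fin_two`).
[cite: Tao2005FiniteFieldBesicovitch4D, Prop. 1.3 (§1, p. 338)] -/
theorem natCard_Z [Fintype K] [DecidableEq K] :
    Nat.card (Z : Set M) = Fintype.card K * (Fintype.card K ^ 2 - 1) := by
  rw [Nat.card_congr (zEquivSL (K := K)),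
    Literature.NumberTheory.GaloisRepresentations.SL2Wreath.natCard_specialLinearGroup_fin_two]

/-- **Tao 2005, Proposition 1.3, for the split form `⟨x, x⟩ = det x` on `M₂(𝔽_q) ≅ 𝔽_q⁴`, with exact
counts** (`q ≥ 3`, any characteristic): the "unit sphere" `Z = {det = 1}` has `q (q² − 1) ∼ q³`
points; the family `linesInZ` of all lines contained in `Z` — Tao's `L` (`char ≠ 2`), by
`linesThrough_eq` — has `(q − 1)(q + 1)² ∼ q³` members, exactly `q + 1` of them through each point
of `Z`; and every affine 2-plane contains at most two of them (the Wolff axiom for `k = 2`, sharp).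
The directions of these lines are singular matrices (`det_direction_eq_zero`), so the lines do not
point in different directions (the identifier `prop3_split` keeps the arXiv numbering "Prop. 3").
[cite: Tao2005FiniteFieldBesicovitch4D, Prop. 1.3 (§1, p. 338)] -/
theorem prop3_split [Fintype K] [DecidableEq K] (hK : 2 < Fintype.card K) :
    Nat.card (Z : Set M) = Fintype.card K * (Fintype.card K ^ 2 - 1) ∧
      Nat.card (linesInZ : Set (Set M)) = (Fintype.card K - 1) * (Fintype.card K + 1) ^ 2 ∧
      (∀ g : M, g ∈ Z → (linesThrough g).ncard = Fintype.card K + 1) ∧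
      ∀ (P U V : M) (ℓ₁ ℓ₂ ℓ₃ : Set M), ℓ₁ ∈ linesInZ → ℓ₂ ∈ linesInZ → ℓ₃ ∈ linesInZ →
        ℓ₁ ⊆ plane P U V → ℓ₂ ⊆ plane P U V → ℓ₃ ⊆ plane P U V → ℓ₁ ≠ ℓ₂ →
        ℓ₃ = ℓ₁ ∨ ℓ₃ = ℓ₂ := by
  have h3 : ∃ c : K, c ≠ 0 ∧ c ≠ 1 := two_lt_card_iff.1 hK
  refine ⟨natCard_Z, natCard_linesInZ' h3, fun g hg => ?_,
    fun P U V ℓ₁ ℓ₂ ℓ₃ h₁ h₂ h₃ hA₁ hA₂ hA₃ h12 =>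
      no_three_lines_in_plane h3 h₁ h₂ h₃ hA₁ hA₂ hA₃ h12⟩
  rw [ncard_linesThrough (det_eq_one_of_mem_Z hg) h3, Nat.card_eq_fintype_card]

end Assembly


/-! ## The Wolff axiom for `k = 3`: lines of `Z` in an affine 3-space

Every affine 3-space of `M₂(K) ≅ K⁴` lies in a hyperplane `hyperplane A c = {X : tr (A X) = c}`,
`A ≠ 0` (`exists_hyperplane_of_space`).  Two double counts bound the number `L` of lines of `Z`
inside such an `H` for `K = 𝔽_q`, `q ≥ 3`:
* over the points of `Z ∩ H`: through `g ∈ Z ∩ H` pass at most two lines of `Z` lying in `H`,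
  unless `A g` is scalar (then `H` is the tangent hyperplane at `g`, which happens for at most one
  `g`), so `q L ≤ 2 |Z ∩ H| + q − 1` and, with `|Z ∩ H| ≤ |Z|`, `L ≤ 2 (q² − 1)` — the `k = 3`
  clause of Tao's Definition 1.1 (`O(|F|^{k−1})` lines in every affine `k`-space), constant `2`;
* over all lines of `Z` meeting `H`: `(q + 1) |Z ∩ H| + L ≤ q L + (q − 1)(q + 1)²`, which together
  with the first count gives `L ≤ 2q + 5`: Tao's "`O(|F|)` lines in every 3-space" (p. 342) with
  an explicit constant.  The sharp value `2 (q + 1)` follows in section `PointCount` from the point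
  count `|Z ∩ H| ≤ q (q + 1)` (`ncard_linesInZIn_hyperplane_le_sharp`). -/

section ThreeSpace

local notation "M" => Matrix (Fin 2) (Fin 2) K

/-- The affine hyperplane `{X : tr (A X) = c}` of `M₂(K) ≅ K⁴` (a genuine hyperplane when `A ≠ 0`;
every affine hyperplane is of this form, the trace pairing being perfect). [folklore] -/
def hyperplane (A : M) (c : K) : Set M := {X | (A * X).trace = c}

/-- The affine subspace through `P` spanned by `U, V, W`, as a point set: an affine 3-space when
`U, V, W` are linearly independent, a plane, line or point otherwise. [folklore] -/
def space (P U V W : M) : Set M := {X | ∃ r s t : K, X = P + r • U + s • V + t • W}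

/-- The lines of `Z` (members of `linesInZ`) contained in a set `S`. [folklore] -/
def linesInZIn (S : Set M) : Set (Set M) := {ℓ | ℓ ∈ linesInZ ∧ ℓ ⊆ S}

/-- The lines of `Z` through `g` contained in a set `S`. [folklore] -/
def linesThroughIn (g : M) (S : Set M) : Set (Set M) := {ℓ | ℓ ∈ linesThrough g ∧ ℓ ⊆ S}

/-- Membership in a hyperplane, unfolded. [folklore] -/
theorem mem_hyperplane_iff {A : M} {c : K} {X : M} : X ∈ hyperplane A c ↔ (A * X).trace = c :=
  Iff.rfl

/-- A line lies in the hyperplane `{tr (A X) = c}` iff its base point does and its direction is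
killed by `tr (A ·)`. [folklore] -/
theorem line_subset_hyperplane_iff {A : M} {c : K} {g D : M} :
    line g D ⊆ hyperplane A c ↔ (A * g).trace = c ∧ (A * D).trace = 0 := by
  constructor
  · intro h
    have h0 : (A * g).trace = c := by
      have := h (mem_line_self g D)
      exact this
    have h1 : (A * (g + (1 : K) • D)).trace = c := h ⟨1, rfl⟩
    rw [one_smul, mul_add, trace_add, h0] at h1
    exact ⟨h0, by linear_combination h1⟩
  · rintro ⟨h0, h1⟩ X ⟨t, rfl⟩
    show (A * (g + t • D)).trace = c
    rw [mul_add, Matrix.mul_smul, trace_add, trace_smul, h0, h1, smul_zero, add_zero]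

/-- Every parametrised affine subspace `{P + r U + s V + t W}` of `M₂(K) ≅ K⁴` lies in an affine
hyperplane `{tr (A X) = c}` with `A ≠ 0` (three linear conditions on the four entries of `A`).
[folklore] -/
theorem exists_hyperplane_of_space (P U V W : M) :
    ∃ A : M, A ≠ 0 ∧ ∃ c : K, space P U V W ⊆ hyperplane A c := by
  -- the linear map `A ↦ (tr (A U), tr (A V), tr (A W))`
  let τ : M → (M →ₗ[K] K) := fun Y =>
    (Matrix.traceLinearMap (Fin 2) K K).comp (LinearMap.mulRight K Y)
  let f : M →ₗ[K] (Fin 3 → K) := LinearMap.pi (fun i => (![τ U, τ V, τ W] : Fin 3 → (M →ₗ[K] K)) i)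
  have hlt : Module.finrank K (Fin 3 → K) < Module.finrank K M := by
    rw [Module.finrank_fintype_fun_eq_card, Module.finrank_matrix]
    simp
  have hker : LinearMap.ker f ≠ ⊥ := LinearMap.ker_ne_bot_of_finrank_lt hlt
  obtain ⟨A, hAker, hA0⟩ := (Submodule.ne_bot_iff _).1 hker
  have hfA : f A = 0 := hAker
  have hU : (A * U).trace = 0 := by
    have := congrFun hfA 0
    simpa [f, τ] using this
  have hV : (A * V).trace = 0 := by
    have := congrFun hfA 1
    simpa [f, τ] using this
  have hW : (A * W).trace = 0 := by
    have := congrFun hfA 2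
    simpa [f, τ] using this
  refine ⟨A, hA0, (A * P).trace, ?_⟩
  rintro X ⟨r, s, t, rfl⟩
  show (A * (P + r • U + s • V + t • W)).trace = (A * P).trace
  rw [mul_add, mul_add, mul_add, Matrix.mul_smul, Matrix.mul_smul, Matrix.mul_smul, trace_add,
    trace_add, trace_add, trace_smul, trace_smul, trace_smul, hU, hV, hW]
  simp

/-! ### Lines of `Z` through a point inside a hyperplane: at most two, except at one point

The lines of `Z` through `g` are `line g (g * rep o)`, `o : Option K`; such a line lies in
`H = {tr (A X) = c}` (with `g ∈ H`) iff `tr (B * rep o) = 0` for `B = A g`, a polynomial condition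
of degree `≤ 2` in the parameter of `rep o`.  It has at most two solutions unless `B` is scalar,
and `A g` is scalar for at most one point `g ∈ Z ∩ H` (then `H` is the tangent hyperplane of `Z` at
`g` and contains all `q + 1` lines through `g`). -/

/-- `tr (B * rep (some a)) = −B₀₁ a² + (B₀₀ − B₁₁) a + B₁₀`. [folklore] -/
theorem trace_mul_rep_some (B : M) (a : K) :
    (B * rep (some a)).trace = -(B 0 1) * a ^ 2 + (B 0 0 - B 1 1) * a + B 1 0 := by
  simp [rep, Matrix.trace_fin_two, Matrix.mul_apply, Fin.sum_univ_two]
  ring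

/-- `tr (B * rep none) = B₀₁`. [folklore] -/
theorem trace_mul_rep_none (B : M) : (B * rep none).trace = B 0 1 := by
  simp [rep, Matrix.trace_fin_two, Matrix.mul_apply, Fin.sum_univ_two]

/-- A `2 × 2` matrix is *scalar* when it is a multiple of the identity (entrywise form).
[folklore] -/
def IsScalar (B : M) : Prop := B 0 1 = 0 ∧ B 1 0 = 0 ∧ B 0 0 = B 1 1

/-- A scalar matrix is `B₀₀ • 1`. [folklore] -/
theorem IsScalar.eq_smul_one {B : M} (h : IsScalar B) : B = B 0 0 • (1 : M) := by
  obtain ⟨h01, h10, hdiag⟩ := h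
  ext i j
  fin_cases i <;> fin_cases j <;> simp [h01, h10, hdiag]

/-- If `tr (B * rep o) = 0` for three distinct `o`, then `B` is scalar (a nonzero polynomial of
degree `≤ 2` has at most two roots; the value `o = none` plays the role of the point at infinity).
[folklore] -/
theorem isScalar_of_three_roots {B : M} {o₁ o₂ o₃ : Option K}
    (h₁ : (B * rep o₁).trace = 0) (h₂ : (B * rep o₂).trace = 0) (h₃ : (B * rep o₃).trace = 0)
    (h12 : o₁ ≠ o₂) (h13 : o₁ ≠ o₃) (h23 : o₂ ≠ o₃) : IsScalar B := by
  -- reduce to: `none` is among them, or all three are `some`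
  have key : ∀ {a₁ a₂ : K}, a₁ ≠ a₂ → (B * rep (some a₁)).trace = 0 →
      (B * rep (some a₂)).trace = 0 → -(B 0 1) * (a₁ + a₂) + (B 0 0 - B 1 1) = 0 := by
    intro a₁ a₂ hne e₁ e₂
    rw [trace_mul_rep_some] at e₁ e₂
    have hsub : (a₁ - a₂) * (-(B 0 1) * (a₁ + a₂) + (B 0 0 - B 1 1)) = 0 := by
      linear_combination e₁ - e₂
    rcases mul_eq_zero.1 hsub with h | h
    · exact absurd (sub_eq_zero.1 h) hne
    · exact h
  have withNone : ∀ {a₁ a₂ : K}, a₁ ≠ a₂ → (B * rep none).trace = 0 →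
      (B * rep (some a₁)).trace = 0 → (B * rep (some a₂)).trace = 0 → IsScalar B := by
    intro a₁ a₂ hne e₀ e₁ e₂
    have k := key hne e₁ e₂
    rw [trace_mul_rep_none] at e₀
    rw [trace_mul_rep_some, e₀] at e₁
    rw [e₀] at k
    have hd : B 0 0 - B 1 1 = 0 := by linear_combination k
    refine ⟨e₀, ?_, sub_eq_zero.1 hd⟩
    linear_combination e₁ - a₁ * hd
  rcases o₁ with _ | a₁ <;> rcases o₂ with _ | a₂ <;> rcases o₃ with _ | a₃
  · exact absurd rfl h12
  · exact absurd rfl h12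
  · exact absurd rfl h13
  · exact withNone (fun h => h23 (by rw [h])) h₁ h₂ h₃
  · exact absurd rfl h23
  · exact withNone (fun h => h13 (by rw [h])) h₂ h₁ h₃
  · exact withNone (fun h => h12 (by rw [h])) h₃ h₁ h₂
  · -- three finite roots
    have n12 : a₁ ≠ a₂ := fun h => h12 (by rw [h])
    have n13 : a₁ ≠ a₃ := fun h => h13 (by rw [h])
    have n23 : a₂ ≠ a₃ := fun h => h23 (by rw [h])
    have k12 := key n12 h₁ h₂
    have k13 := key n13 h₁ h₃
    have hb : B 0 1 * (a₂ - a₃) = 0 := by linear_combination k13 - k12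
    have h01 : B 0 1 = 0 := by
      rcases mul_eq_zero.1 hb with h | h
      · exact h
      · exact absurd (sub_eq_zero.1 h) n23
    have hd : B 0 0 - B 1 1 = 0 := by rw [h01] at k12; linear_combination k12
    rw [trace_mul_rep_some, h01] at h₁
    refine ⟨h01, ?_, sub_eq_zero.1 hd⟩
    linear_combination h₁ - a₁ * hd

/-- Hence, for non-scalar `B`, at most two parameters `o` satisfy `tr (B * rep o) = 0`.
[folklore] -/
theorem ncard_roots_le_two [Finite K] {B : M} (hB : ¬ IsScalar B) :
    {o : Option K | (B * rep o).trace = 0}.ncard ≤ 2 := by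
  by_contra h
  obtain ⟨o₁, o₂, o₃, h₁, h₂, h₃, h12, h13, h23⟩ := (Set.two_lt_ncard_iff).1 (not_le.1 h)
  exact hB (isScalar_of_three_roots h₁ h₂ h₃ h12 h13 h23)

/-- **The exceptional point is unique.** If `A ≠ 0` and `A g` is scalar for a point `g ∈ Z ∩ H`,
`H = {tr (A X) = c}`, then `g` is determined: `A g = b • 1` forces `A = b g⁻¹`, `b² = det A` and
`2b = c`, and these pin down `b` (in characteristic `2` because squaring is injective).
Geometrically, `H` is then the tangent hyperplane of `Z` at `g`. [folklore] -/
theorem eq_of_isScalar {A g₁ g₂ : M} {c : K} (hA : A ≠ 0) (hg₁ : g₁.det = 1) (hg₂ : g₂.det = 1)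
    (hH₁ : (A * g₁).trace = c) (hH₂ : (A * g₂).trace = c) (hs₁ : IsScalar (A * g₁))
    (hs₂ : IsScalar (A * g₂)) : g₁ = g₂ := by
  set b₁ := (A * g₁) 0 0 with hb₁
  set b₂ := (A * g₂) 0 0 with hb₂
  have e₁ : A * g₁ = b₁ • (1 : M) := hs₁.eq_smul_one
  have e₂ : A * g₂ = b₂ • (1 : M) := hs₂.eq_smul_one
  clear_value b₁ b₂
  -- determinants: det A = bᵢ²
  have d₁ : A.det = b₁ ^ 2 := by
    have := congrArg Matrix.det e₁
    rw [Matrix.det_mul, hg₁, mul_one, Matrix.det_smul, Matrix.det_one, mul_one,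
      Fintype.card_fin] at this
    exact this
  have d₂ : A.det = b₂ ^ 2 := by
    have := congrArg Matrix.det e₂
    rw [Matrix.det_mul, hg₂, mul_one, Matrix.det_smul, Matrix.det_one, mul_one,
      Fintype.card_fin] at this
    exact this
  -- traces: 2 bᵢ = c
  have t₁ : b₁ * 2 = c := by
    rw [e₁, trace_smul, trace_one, Fintype.card_fin, smul_eq_mul] at hH₁
    exact_mod_cast hH₁
  have t₂ : b₂ * 2 = c := by
    rw [e₂, trace_smul, trace_one, Fintype.card_fin, smul_eq_mul] at hH₂
    exact_mod_cast hH₂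
  -- b₁ ≠ 0 (else A = 0)
  have hg₁u : IsUnit g₁.det := by rw [hg₁]; exact isUnit_one
  have hb₁0 : b₁ ≠ 0 := by
    intro h0
    apply hA
    rw [h0, zero_smul] at e₁
    have : A * g₁ * g₁⁻¹ = 0 := by rw [e₁, zero_mul]
    rwa [mul_assoc, Matrix.mul_nonsing_inv g₁ hg₁u, mul_one] at this
  -- b₁ = b₂
  have hb : b₁ = b₂ := by
    have hsq : (b₁ - b₂) * (b₁ + b₂) = 0 := by linear_combination d₁.symm.trans d₂
    rcases mul_eq_zero.1 hsq with h | h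
    · exact sub_eq_zero.1 h
    · -- b₂ = -b₁ and 2 b₁ = 2 b₂ force 4 b₁ = 0, hence 2 = 0, hence b₂ = b₁
      have h4 : b₁ * (2 * 2) = 0 := by linear_combination t₁ - t₂ + 2 * h
      have h22 : (2 : K) * 2 = 0 := by
        rcases mul_eq_zero.1 h4 with h' | h'
        · exact absurd h' hb₁0
        · exact h'
      have h2 : (2 : K) = 0 := by
        rcases mul_eq_zero.1 h22 with h' | h' <;> exact h'
      linear_combination h - b₂ * h2
  -- cancel the invertible matrix A
  have hAu : IsUnit A.det := by
    rw [d₁]; exact IsUnit.pow 2 (Ne.isUnit hb₁0)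
  calc g₁ = A⁻¹ * (A * g₁) := by rw [← mul_assoc, Matrix.nonsing_inv_mul A hAu, one_mul]
    _ = A⁻¹ * (A * g₂) := by rw [e₁, e₂, hb]
    _ = g₂ := by rw [← mul_assoc, Matrix.nonsing_inv_mul A hAu, one_mul]

/-- The lines of `Z` through `g` inside `H = {tr (A X) = c}` are among the `line g (g * rep o)` with
`tr (A g · rep o) = 0` (`det g = 1`, `|K| ≥ 3`). [folklore] -/
theorem linesThroughIn_hyperplane_subset {g A : M} {c : K} (hg : g.det = 1)
    (h3 : ∃ c : K, c ≠ 0 ∧ c ≠ 1) :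
    linesThroughIn g (hyperplane A c) ⊆
      (fun o : Option K => line g (g * rep o)) '' {o | (A * g * rep o).trace = 0} := by
  rintro ℓ ⟨hℓ, hH⟩
  rw [linesThrough_eq hg h3] at hℓ
  obtain ⟨o, rfl⟩ := hℓ
  refine ⟨o, ?_, rfl⟩
  have h := (line_subset_hyperplane_iff.1 hH).2
  show (A * g * rep o).trace = 0
  rwa [mul_assoc]

/-- **Multiplicity bound.** Through a point `g` of `Z` with `A g` not scalar pass at most two lines
of `Z` contained in `H = {tr (A X) = c}`. [cite: Tao2005FiniteFieldBesicovitch4D, Prop. 1.3, proof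
(§3, p. 342): "there are `O(|F|)` choices of `x`" in the non-tangent case] -/
theorem ncard_linesThroughIn_le_two [Finite K] {g A : M} {c : K} (hg : g.det = 1)
    (h3 : ∃ c : K, c ≠ 0 ∧ c ≠ 1) (hs : ¬ IsScalar (A * g)) :
    (linesThroughIn g (hyperplane A c)).ncard ≤ 2 :=
  ((Set.ncard_le_ncard (linesThroughIn_hyperplane_subset hg h3)).trans
    (Set.ncard_image_le (Set.toFinite _))).trans (ncard_roots_le_two hs)

/-- Trivial multiplicity bound: at most `q + 1` lines of `Z` through any point lie in `H` (there are
only `q + 1` lines of `Z` through the point). [folklore] -/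
theorem ncard_linesThroughIn_le_card [Finite K] {g A : M} {c : K} (hg : g.det = 1)
    (h3 : ∃ c : K, c ≠ 0 ∧ c ≠ 1) :
    (linesThroughIn g (hyperplane A c)).ncard ≤ Nat.card K + 1 := by
  refine ((Set.ncard_le_ncard (linesThroughIn_hyperplane_subset hg h3)).trans
    (Set.ncard_image_le (Set.toFinite _))).trans ?_
  have := Set.ncard_le_card {o : Option K | (A * g * rep o).trace = 0}
  rwa [Finite.card_option] at this

/-! ### Double counting inside a hyperplane

Incidences `(g, ℓ)` with `ℓ` a line of `Z` contained in `S` and `g ∈ ℓ` are counted over the lines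
(`q` points each) and over the points `g ∈ Z ∩ S` (multiplicities as above). -/

/-- The incidence set `{(g, ℓ) : ℓ ⊆ S a line of Z, g ∈ ℓ}`, fibred over the points of `Z ∩ S` and
over the lines of `Z` inside `S`. [folklore] -/
def incidenceEquivIn (S : Set M) :
    (Σ g : (Z ∩ S : Set M), (linesThroughIn (g : M) S : Set (Set M))) ≃
      (Σ ℓ : (linesInZIn S : Set (Set M)), (ℓ : Set M)) where
  toFun x := ⟨⟨x.2.1, mem_linesInZ_of_mem_linesThrough x.2.2.1, x.2.2.2⟩,
    ⟨x.1.1, self_mem_of_mem_linesThrough x.2.2.1⟩⟩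
  invFun y := ⟨⟨y.2.1, mem_Z_of_mem_linesInZ y.1.2.1 y.2.2, y.1.2.2 y.2.2⟩,
    ⟨y.1.1, mem_linesThrough_of_mem y.1.2.1 y.2.2, y.1.2.2⟩⟩
  left_inv _ := rfl
  right_inv _ := rfl

/-- The incidence set over the lines inside `S` has `#(lines of Z in S) · |K|` elements.
[folklore] -/
theorem natCard_incidenceIn_right (S : Set M) :
    Nat.card (Σ ℓ : (linesInZIn S : Set (Set M)), (ℓ : Set M)) =
      Nat.card (linesInZIn S : Set (Set M)) * Nat.card K := by
  have e : (Σ ℓ : (linesInZIn S : Set (Set M)), (ℓ : Set M)) ≃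
      Prod (↥(linesInZIn S : Set (Set M))) K :=
    (Equiv.sigmaCongrRight fun ℓ => lineEquiv ℓ.2.1).trans (Equiv.sigmaEquivProd _ _)
  rw [Nat.card_congr e, Nat.card_prod]

/-- **Incidence bound in a hyperplane** (`K` finite, `|K| ≥ 3`, `A ≠ 0`):
`#(lines of Z in H) · q ≤ 2 · |Z ∩ H| + (q − 1)` for `H = {tr (A X) = c}` — every point of `Z ∩ H`
carries at most two lines of `Z` inside `H`, except at most one point carrying all its `q + 1`
lines. [cite: Tao2005FiniteFieldBesicovitch4D, Prop. 1.3, proof (§3, p. 342)] -/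
theorem ncard_linesInZIn_mul_card_le [Finite K] (h3 : ∃ c : K, c ≠ 0 ∧ c ≠ 1) {A : M}
    (hA : A ≠ 0) (c : K) :
    (linesInZIn (hyperplane A c)).ncard * Nat.card K ≤
      2 * (Z ∩ hyperplane A c : Set M).ncard + (Nat.card K - 1) := by
  classical
  set H := hyperplane A c with hHdef
  haveI : Fintype (Z ∩ H : Set M) := Fintype.ofFinite _
  have hcount : (linesInZIn H).ncard * Nat.card K =
      ∑ g : (Z ∩ H : Set M), (linesThroughIn (g : M) H).ncard := by
    rw [← Nat.card_coe_set_eq, ← natCard_incidenceIn_right, ← Nat.card_congr (incidenceEquivIn H),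
      Nat.card_sigma]
    simp only [Nat.card_coe_set_eq]
  rw [hcount]
  -- split off the (at most one) point `g` with `A g` scalar
  let bad : (Z ∩ H : Set M) → Prop := fun g => IsScalar (A * (g : M))
  let m : (Z ∩ H : Set M) → ℕ := fun g => (linesThroughIn (g : M) H).ncard
  show ∑ g, m g ≤ _
  rw [← Finset.sum_filter_add_sum_filter_not Finset.univ bad m]
  have hbad_card : (Finset.univ.filter bad).card ≤ 1 := by
    rw [Finset.card_le_one]
    intro a ha b hb
    simp only [Finset.mem_filter, Finset.mem_univ, true_and] at ha hb
    exact Subtype.ext (eq_of_isScalar hA (det_eq_one_of_mem_Z a.2.1) (det_eq_one_of_mem_Z b.2.1)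
      (mem_hyperplane_iff.1 a.2.2) (mem_hyperplane_iff.1 b.2.2) ha hb)
  have hbad_sum : ∑ g ∈ Finset.univ.filter bad, m g ≤
      (Finset.univ.filter bad).card • (Nat.card K + 1) :=
    Finset.sum_le_card_nsmul _ _ _
      (fun g _ => ncard_linesThroughIn_le_card (det_eq_one_of_mem_Z g.2.1) h3)
  have hgood_sum : ∑ g ∈ Finset.univ.filter (fun g => ¬ bad g), m g ≤
      (Finset.univ.filter (fun g => ¬ bad g)).card • 2 :=
    Finset.sum_le_card_nsmul _ _ _
      (fun g hg => ncard_linesThroughIn_le_two (det_eq_one_of_mem_Z g.2.1) h3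
        (by simpa using hg))
  refine (add_le_add hbad_sum hgood_sum).trans ?_
  rw [smul_eq_mul, smul_eq_mul]
  have hcards := Finset.card_filter_add_card_filter_not
    (s := (Finset.univ : Finset (Z ∩ H : Set M))) bad
  rw [Finset.card_univ, ← Nat.card_eq_fintype_card, Nat.card_coe_set_eq] at hcards
  rw [← hcards]
  have hq1 : 1 ≤ Nat.card K := Nat.one_le_iff_ne_zero.2 Nat.card_pos.ne'
  -- arithmetic: nb (q + 1) + 2 ng ≤ 2 (nb + ng) + (q − 1) for nb ≤ 1 ≤ q
  generalize hq : Nat.card K = q at hq1 ⊢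
  generalize (Finset.univ.filter (fun g => ¬ bad g)).card = ng
  rcases Nat.le_one_iff_eq_zero_or_eq_one.1 hbad_card with h0 | h1
  · rw [h0]; omega
  · rw [h1]; omega

/-- **The Wolff axiom, `k = 3` (Tao's Definition 1.1), for the lines of `Z = SL₂(𝔽_q)`:** every
affine hyperplane `{X : tr (A X) = c}` (`A ≠ 0`) of `M₂(𝔽_q) ≅ 𝔽_q⁴` contains at most
`2 (q² − 1) = O(|F|^{k−1})` of the `(q − 1)(q + 1)²` lines contained in `Z` (`q ≥ 3`).  The constant
comes from the incidence bound `ncard_linesInZIn_mul_card_le` and `|Z ∩ H| ≤ |Z| = q (q² − 1)`; the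
second double count below improves this to `2q + 5 = O(|F|)`
(`ncard_linesInZIn_hyperplane_le_linear`, Tao's bound, p. 342), and classically a hyperplane
section of the quadric carries at most `2 (q + 1)` lines.
[cite: Tao2005FiniteFieldBesicovitch4D, Prop. 1.3 (§1, p. 338: "obeys the Wolff axiom"), Def. 1.1,
proof §3 (p. 342: "implies the Wolff axiom for both `k = 2` and `k = 3`")] -/
theorem ncard_linesInZIn_hyperplane_le [Fintype K] [DecidableEq K] (hK : 2 < Fintype.card K)
    {A : M} (hA : A ≠ 0) (c : K) :
    (linesInZIn (hyperplane A c)).ncard ≤ 2 * (Fintype.card K ^ 2 - 1) := by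
  have h3 : ∃ c : K, c ≠ 0 ∧ c ≠ 1 := two_lt_card_iff.1 hK
  have h := ncard_linesInZIn_mul_card_le h3 hA c
  have hZ : (Z ∩ hyperplane A c : Set M).ncard ≤ Fintype.card K * (Fintype.card K ^ 2 - 1) := by
    rw [← natCard_Z (K := K), ← Nat.card_coe_set_eq]
    exact Nat.card_mono (Set.toFinite _) Set.inter_subset_left
  rw [Nat.card_eq_fintype_card] at h
  set q := Fintype.card K with hq
  set L := (linesInZIn (hyperplane A c)).ncard with hL
  set n := (Z ∩ hyperplane A c : Set M).ncard with hn
  have hq1 : 1 ≤ q := Fintype.card_pos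
  generalize hm : q ^ 2 - 1 = m at hZ ⊢
  generalize hN : q * m = N at hZ
  have key : L * q < (2 * m + 1) * q := by
    have e : (2 * m + 1) * q = 2 * N + q := by rw [← hN]; ring
    rw [e]
    omega
  exact Nat.lt_succ_iff.1 (Nat.lt_of_mul_lt_mul_right key)

/-- **The Wolff axiom, `k = 3`, for parametrised affine subspaces:** every `{P + r U + s V + t W}` —
in particular every affine 3-space of `M₂(𝔽_q) ≅ 𝔽_q⁴` — contains at most `2 (q² − 1)` lines of `Z`
(`q ≥ 3`; true for all `U, V, W`, degenerate spans included).
[cite: Tao2005FiniteFieldBesicovitch4D, Prop. 1.3 (§1, p. 338) with Def. 1.1 (`k = 3`)] -/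
theorem ncard_linesInZIn_space_le [Fintype K] [DecidableEq K] (hK : 2 < Fintype.card K)
    (P U V W : M) : (linesInZIn (space P U V W)).ncard ≤ 2 * (Fintype.card K ^ 2 - 1) := by
  obtain ⟨A, hA, c, hsub⟩ := exists_hyperplane_of_space P U V W
  refine (Set.ncard_le_ncard ?_ (Set.toFinite _)).trans (ncard_linesInZIn_hyperplane_le hK hA c)
  rintro ℓ ⟨hℓ, hS⟩
  exact ⟨hℓ, hS.trans hsub⟩

/-! ### Tao's `O(|F|)` bound: a second double count

Counting pairs `(g, ℓ)` with `g ∈ Z ∩ H` and `ℓ` *any* line of `Z` through `g`: each of the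
`|Z ∩ H|` points carries `q + 1` lines, while a line of `Z` contributes `q` such pairs if it lies in
`H` and at most one otherwise.  Hence `(q + 1) |Z ∩ H| ≤ q L + (T − L)`, `T = (q − 1)(q + 1)²` the
total number of lines of `Z`, `L` the number of those inside `H`; combined with the incidence bound
`q L ≤ 2 |Z ∩ H| + q − 1` this gives `L (q² − q + 2) ≤ (q² − 1)(2q + 3)`, so `L ≤ 2q + 5`. -/

/-- A line not contained in the hyperplane `H` meets it in at most one point. [folklore] -/
theorem subsingleton_line_inter_hyperplane {P V A : M} {c : K}
    (h : ¬ line P V ⊆ hyperplane A c) : (line P V ∩ hyperplane A c).Subsingleton := by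
  rintro X ⟨⟨t, rfl⟩, hX⟩ Y ⟨⟨s, rfl⟩, hY⟩
  have hX' : (A * (P + t • V)).trace = c := hX
  have hY' : (A * (P + s • V)).trace = c := hY
  rw [mul_add, Matrix.mul_smul, trace_add, trace_smul, smul_eq_mul] at hX' hY'
  by_cases hV : (A * V).trace = 0
  · -- then the base point is in `H` and so is the whole line: contradiction
    exfalso
    apply h
    rw [line_subset_hyperplane_iff]
    refine ⟨?_, hV⟩
    rw [hV, mul_zero, add_zero] at hX'
    exact hX'
  · have hts : (t - s) * (A * V).trace = 0 := by linear_combination hX' - hY'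
    have : t = s := by
      rcases mul_eq_zero.1 hts with h' | h'
      · exact sub_eq_zero.1 h'
      · exact absurd h' hV
    simp only [this]

/-- The pairs `(g, ℓ)`, `g ∈ Z ∩ S`, `ℓ` a line of `Z` through `g`, fibred over the points and over
all lines of `Z` (with fibre `ℓ ∩ S`). [folklore] -/
def meetEquiv (S : Set M) :
    (Σ g : (Z ∩ S : Set M), (linesThrough (g : M) : Set (Set M))) ≃
      (Σ ℓ : (linesInZ (K := K) : Set (Set M)), ((ℓ : Set M) ∩ S : Set M)) where
  toFun x := ⟨⟨x.2.1, mem_linesInZ_of_mem_linesThrough x.2.2⟩,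
    ⟨x.1.1, self_mem_of_mem_linesThrough x.2.2, x.1.2.2⟩⟩
  invFun y := ⟨⟨y.2.1, mem_Z_of_mem_linesInZ y.1.2 y.2.2.1, y.2.2.2⟩,
    ⟨y.1.1, mem_linesThrough_of_mem y.1.2 y.2.2.1⟩⟩
  left_inv _ := rfl
  right_inv _ := rfl

/-- The lines of `Z` inside `S`, as a subtype of the lines of `Z`. [folklore] -/
def linesInZInEquiv (S : Set M) :
    {ℓ : ↥(linesInZ (K := K)) // (ℓ.1 : Set M) ⊆ S} ≃ (linesInZIn S : Set (Set M)) where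
  toFun ℓ := ⟨ℓ.1.1, ℓ.1.2, ℓ.2⟩
  invFun ℓ := ⟨⟨ℓ.1, ℓ.2.1⟩, ℓ.2.2⟩
  left_inv _ := rfl
  right_inv _ := rfl

/-- **Second double count** (`K` finite, `|K| ≥ 3`): with `n = |Z ∩ H|`, `L` the number of lines of
`Z` inside `H = {tr (A X) = c}` and `T` the number of all lines of `Z`, `(q + 1) n + L ≤ q L + T`.
[folklore] -/
theorem card_inter_hyperplane_mul_le [Fintype K] [DecidableEq K] (h3 : ∃ c : K, c ≠ 0 ∧ c ≠ 1)
    (A : M) (c : K) :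
    (Z ∩ hyperplane A c : Set M).ncard * (Fintype.card K + 1) +
        (linesInZIn (hyperplane A c)).ncard ≤
      (linesInZIn (hyperplane A c)).ncard * Fintype.card K +
        Nat.card (linesInZ (K := K) : Set (Set M)) := by
  classical
  set H := hyperplane A c with hHdef
  haveI : Fintype (Z ∩ H : Set M) := Fintype.ofFinite _
  haveI : Fintype ↥(linesInZ (K := K)) := Fintype.ofFinite _
  -- left count: n (q + 1)
  have hleft : Nat.card (Σ g : (Z ∩ H : Set M), (linesThrough (g : M) : Set (Set M))) =
      (Z ∩ H : Set M).ncard * (Fintype.card K + 1) := by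
    rw [Nat.card_sigma]
    have hfib : ∀ g : (Z ∩ H : Set M), Nat.card (linesThrough (g : M) : Set (Set M)) =
        Fintype.card K + 1 := by
      intro g
      rw [Nat.card_coe_set_eq, ncard_linesThrough (det_eq_one_of_mem_Z g.2.1) h3,
        Nat.card_eq_fintype_card]
    simp only [hfib, Finset.sum_const, Finset.card_univ, smul_eq_mul]
    rw [← Nat.card_eq_fintype_card, Nat.card_coe_set_eq]
  -- right count: Σ_ℓ |ℓ ∩ H| ≤ L q + (T − L)
  let p : ↥(linesInZ (K := K)) → Prop := fun ℓ => (ℓ.1 : Set M) ⊆ H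
  let f : ↥(linesInZ (K := K)) → ℕ := fun ℓ => ((ℓ.1 : Set M) ∩ H : Set M).ncard
  have hright : Nat.card (Σ ℓ : ↥(linesInZ (K := K)), ((ℓ : Set M) ∩ H : Set M)) =
      ∑ ℓ, f ℓ := by
    rw [Nat.card_sigma]
    simp only [Nat.card_coe_set_eq, f]
  have hin : ∑ ℓ ∈ Finset.univ.filter p, f ℓ ≤ (Finset.univ.filter p).card • Fintype.card K := by
    refine Finset.sum_le_card_nsmul _ _ _ (fun ℓ _ => ?_)
    calc f ℓ ≤ (ℓ.1 : Set M).ncard := Set.ncard_le_ncard Set.inter_subset_left (Set.toFinite _)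
      _ = Fintype.card K := by
        rw [← Nat.card_coe_set_eq, Nat.card_congr (lineEquiv ℓ.2), Nat.card_eq_fintype_card]
  have hout : ∑ ℓ ∈ Finset.univ.filter (fun ℓ => ¬ p ℓ), f ℓ ≤
      (Finset.univ.filter (fun ℓ => ¬ p ℓ)).card • 1 := by
    refine Finset.sum_le_card_nsmul _ _ _ (fun ℓ hℓ => ?_)
    simp only [Finset.mem_filter, Finset.mem_univ, true_and, p] at hℓ
    obtain ⟨P, V, -, hPV, -⟩ := ℓ.2
    rw [hPV] at hℓ
    have hsub := subsingleton_line_inter_hyperplane hℓ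
    show ((ℓ.1 : Set M) ∩ H).ncard ≤ 1
    rw [hPV]
    exact (Set.ncard_le_one hsub.finite).2 (fun a ha b hb => hsub ha hb)
  have hL : (Finset.univ.filter p).card = (linesInZIn H).ncard := by
    rw [← Fintype.card_subtype, ← Nat.card_eq_fintype_card, Nat.card_congr (linesInZInEquiv H),
      Nat.card_coe_set_eq]
  have hT := Finset.card_filter_add_card_filter_not
    (s := (Finset.univ : Finset ↥(linesInZ (K := K)))) p
  rw [Finset.card_univ, ← Nat.card_eq_fintype_card] at hT
  have hsum := Finset.sum_filter_add_sum_filter_not Finset.univ p f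
  have hE : (Z ∩ H : Set M).ncard * (Fintype.card K + 1) = ∑ ℓ, f ℓ := by
    rw [← hleft, ← hright, Nat.card_congr (meetEquiv H)]
  rw [hE, ← hsum, ← hL, ← hT]
  rw [smul_eq_mul] at hin hout
  rw [mul_one] at hout
  have := add_le_add hin hout
  linarith

/-- **Tao's bound: `O(|F|)` lines of `L` in every 3-space, explicitly.**  Every affine hyperplane
`{X : tr (A X) = c}` (`A ≠ 0`) of `M₂(𝔽_q) ≅ 𝔽_q⁴` contains at most `2q + 5` lines of `Z` (`q ≥ 3`).
From `card_inter_hyperplane_mul_le` and `ncard_linesInZIn_mul_card_le`: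
`L (q² − q + 2) ≤ (q² − 1)(2q + 3)`.  (The sharp value `2 (q + 1)` is
`ncard_linesInZIn_hyperplane_le_sharp` in section `PointCount`; Tao's proof, p. 342, states
`O(|F|)`.) [cite: Tao2005FiniteFieldBesicovitch4D, Prop. 1.3, proof (§3, p. 342): "the number
of lines in `λ` is at most `O(|F|)`"] -/
theorem ncard_linesInZIn_hyperplane_le_linear [Fintype K] [DecidableEq K] (hK : 2 < Fintype.card K)
    {A : M} (hA : A ≠ 0) (c : K) :
    (linesInZIn (hyperplane A c)).ncard ≤ 2 * Fintype.card K + 5 := by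
  have h3 : ∃ c : K, c ≠ 0 ∧ c ≠ 1 := two_lt_card_iff.1 hK
  have h1 := ncard_linesInZIn_mul_card_le h3 hA c
  have h2 := card_inter_hyperplane_mul_le h3 A c
  rw [Nat.card_eq_fintype_card] at h1
  rw [natCard_linesInZ' h3] at h2
  generalize hq : Fintype.card K = q at h1 h2 hK ⊢
  generalize hL : (linesInZIn (hyperplane A c)).ncard = L at h1 h2 ⊢
  generalize hn : (Z ∩ hyperplane A c : Set M).ncard = n at h1 h2
  -- q = p + 1 removes the natural-number subtractions
  obtain ⟨p, rfl⟩ : ∃ p, q = p + 1 := ⟨q - 1, by omega⟩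
  simp only [Nat.add_sub_cancel] at h1 h2
  by_contra hcon
  push Not at hcon
  -- h1 : L (p+1) ≤ 2 n + p ;  h2 : n (p+2) + L ≤ L (p+1) + p (p+2)² ; hcon : 2 (p+1) + 5 < L
  have e1 := Nat.mul_le_mul_left (p + 2) h1
  have e2 := Nat.mul_le_mul_left 2 h2
  have h8 : 2 * p + 8 ≤ L := by omega
  have e3 := Nat.mul_le_mul_right (p ^ 2 + p + 2) h8
  ring_nf at e1 e2 e3
  linarith [Nat.zero_le (p ^ 2), Nat.zero_le (p ^ 3), Nat.zero_le (p * L), Nat.zero_le (p ^ 2 * L),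
    Nat.zero_le (p * n)]

/-- The same bound for parametrised affine subspaces `{P + r U + s V + t W}`, in particular for
every affine 3-space of `M₂(𝔽_q) ≅ 𝔽_q⁴`: at most `2q + 5` lines of `Z` (`q ≥ 3`).
[cite: Tao2005FiniteFieldBesicovitch4D, Prop. 1.3, proof (§3, p. 342)] -/
theorem ncard_linesInZIn_space_le_linear [Fintype K] [DecidableEq K] (hK : 2 < Fintype.card K)
    (P U V W : M) : (linesInZIn (space P U V W)).ncard ≤ 2 * Fintype.card K + 5 := by
  obtain ⟨A, hA, c, hsub⟩ := exists_hyperplane_of_space P U V W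
  refine (Set.ncard_le_ncard ?_ (Set.toFinite _)).trans
    (ncard_linesInZIn_hyperplane_le_linear hK hA c)
  rintro ℓ ⟨hℓ, hS⟩
  exact ⟨hℓ, hS.trans hsub⟩

/-- The `k = 2` clause in counted form: at most two lines of `Z` in any `plane P U V` (`K` finite,
`|K| ≥ 3`).
[cite: Tao2005FiniteFieldBesicovitch4D, Prop. 1.3 (§1, p. 338) with Def. 1.1 (`k = 2`)] -/
theorem ncard_linesInZIn_plane_le [Finite K] (h3 : ∃ c : K, c ≠ 0 ∧ c ≠ 1) (P U V : M) :
    (linesInZIn (plane P U V)).ncard ≤ 2 := by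
  by_contra h
  obtain ⟨ℓ₁, ℓ₂, ℓ₃, ⟨h₁, hA₁⟩, ⟨h₂, hA₂⟩, ⟨h₃, hA₃⟩, h12, h13, h23⟩ :=
    (Set.two_lt_ncard_iff).1 (not_le.1 h)
  rcases no_three_lines_in_plane h3 h₁ h₂ h₃ hA₁ hA₂ hA₃ h12 with e | e
  · exact h13 e.symm
  · exact h23 e.symm

/-- **The Wolff axiom (Tao's Definition 1.1, `n = 4`: `k = 2` and `k = 3`) for the family of all
lines contained in `Z = SL₂(𝔽_q) ⊂ M₂(𝔽_q) ≅ 𝔽_q⁴`** (`q ≥ 3`): every affine 2-plane contains at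
most `2 = O(|F|^{2−1})` and every affine 3-space at most `2 (q² − 1) = O(|F|^{3−1})` of them
(parametrised subspaces `plane P U V`, `space P U V W`, degenerate spans included).  Together with
`prop3_split` this is Proposition 1.3 for the split form: "`L` … obeys the Wolff axiom".
[cite: Tao2005FiniteFieldBesicovitch4D, Prop. 1.3 (§1, p. 338) and Def. 1.1] -/
theorem wolffAxiom_split [Fintype K] [DecidableEq K] (hK : 2 < Fintype.card K) :
    (∀ P U V : M, (linesInZIn (plane P U V)).ncard ≤ 2) ∧
      ∀ P U V W : M, (linesInZIn (space P U V W)).ncard ≤ 2 * (Fintype.card K ^ 2 - 1) :=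
  ⟨fun P U V => ncard_linesInZIn_plane_le (two_lt_card_iff.1 hK) P U V,
    fun P U V W => ncard_linesInZIn_space_le hK P U V W⟩

end ThreeSpace

/-! ## Points of `Z` on a hyperplane and the sharp bound `2 (q + 1)` for 3-spaces

Project `X ∈ Z ∩ H`, `H = {tr (A X) = c}`, to its first row `(X₀₀, X₀₁) = (x, y)`.  For fixed
`(x, y)` the second row `(z, w)` solves the linear system `A₀₁ z + A₁₁ w = c − A₀₀ x − A₁₀ y`,
`−y z + x w = 1`, of determinant `Δ = A₀₁ x + A₁₁ y`: at most one solution when `Δ ≠ 0` (there are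
`q² − q` such first rows if `(A₀₁, A₁₁) ≠ 0`), and when `Δ = 0` the system is consistent for at
most two first rows (a quadratic condition with constant term `1` on the parameter of the line
`Δ = 0`), each with at most `q` solutions; if `A₀₁ = A₁₁ = 0` the admissible first rows form an
affine line (`≤ q` of them), each with at most `q` solutions.  Hence `|Z ∩ H| ≤ q (q + 1)` for every
affine hyperplane, which turns the incidence bound `q L ≤ 2 |Z ∩ H| + q − 1` into the sharp
`L ≤ 2 (q + 1)`: the number of lines on a hyperbolic quadric surface over `𝔽_q`. -/

section PointCount

local notation "M" => Matrix (Fin 2) (Fin 2) K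

/-- Kernel of a nonzero linear form on `K²`: if `u₁ δ₁ + u₂ δ₂ = 0` with `(u₁, u₂) ≠ 0`, then
`(δ₁, δ₂)` is a multiple of `(u₂, −u₁)`. [folklore] -/
theorem exists_eq_mul_of_lin {u₁ u₂ δ₁ δ₂ : K} (hu : u₁ ≠ 0 ∨ u₂ ≠ 0)
    (h : u₁ * δ₁ + u₂ * δ₂ = 0) : ∃ s : K, δ₁ = s * u₂ ∧ δ₂ = -(s * u₁) := by
  by_cases h2 : u₂ = 0
  · have h1 : u₁ ≠ 0 := hu.resolve_right (fun h' => h' h2)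
    have hδ₁ : δ₁ = 0 := by
      have : u₁ * δ₁ = 0 := by rw [h2, zero_mul, add_zero] at h; exact h
      rcases mul_eq_zero.1 this with h' | h'
      · exact absurd h' h1
      · exact h'
    refine ⟨-(δ₂ / u₁), by rw [hδ₁, h2, mul_zero], ?_⟩
    rw [neg_mul, neg_neg, div_mul_cancel₀ δ₂ h1]
  · refine ⟨δ₁ / u₂, by rw [div_mul_cancel₀ δ₁ h2], ?_⟩
    have e : u₂ * δ₂ = -(u₁ * δ₁) := by linear_combination h
    field_simp
    linear_combination e

/-- Two matrices with the same first row whose second rows satisfy the same nonzero linear relation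
lie on a common line, of direction `(0 0; u₂ −u₁)`. [folklore] -/
theorem mem_line_of_sameRow {X₁ X₂ : M} (h00 : X₂ 0 0 = X₁ 0 0) (h01 : X₂ 0 1 = X₁ 0 1)
    {u₁ u₂ : K} (hu : u₁ ≠ 0 ∨ u₂ ≠ 0)
    (h : u₁ * (X₂ 1 0 - X₁ 1 0) + u₂ * (X₂ 1 1 - X₁ 1 1) = 0) :
    X₂ ∈ line X₁ !![0, 0; u₂, -u₁] := by
  obtain ⟨s, hs1, hs2⟩ := exists_eq_mul_of_lin hu h
  refine ⟨s, ?_⟩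
  show X₁ + s • !![0, 0; u₂, -u₁] = X₂
  ext i j
  fin_cases i <;> fin_cases j
  · simp [h00]
  · simp [h01]
  · simp only [Fin.mk_one, Fin.isValue, Fin.zero_eta, Matrix.add_apply, Matrix.smul_apply,
      Matrix.of_apply, Matrix.cons_val', Matrix.cons_val_zero, Matrix.cons_val_one,
      Matrix.cons_val_fin_one, Matrix.empty_val', smul_eq_mul]
    linear_combination -hs1
  · simp only [Fin.mk_one, Fin.isValue, Matrix.add_apply, Matrix.smul_apply, Matrix.of_apply,
      Matrix.cons_val', Matrix.cons_val_one, Matrix.cons_val_fin_one, Matrix.empty_val',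
      smul_eq_mul]
    linear_combination -hs2

/-- A line has at most `|K|` points. [folklore] -/
theorem ncard_line_le [Finite K] (P V : M) : (line P V).ncard ≤ Nat.card K := by
  unfold line
  rw [← Set.image_univ]
  exact (Set.ncard_image_le (Set.finite_univ)).trans (Set.ncard_univ K).le

/-- `tr (A X)` in terms of entries (`2 × 2`). [folklore] -/
theorem trace_mul_eq (A X : M) :
    (A * X).trace = A 0 0 * X 0 0 + A 0 1 * X 1 0 + A 1 0 * X 0 1 + A 1 1 * X 1 1 := by
  rw [Matrix.trace_fin_two, mul_apply_two, mul_apply_two]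
  ring

/-- **Fibre count.** If all points of `S ⊆ M₂(K)` sharing a first row lie on one line, then
`|S| ≤ |K| · #(first rows of S)` (`K` finite). [folklore] -/
theorem ncard_le_card_mul_ncard_image_row [Finite K] {S : Set M}
    (hS : ∀ X₁ ∈ S, ∃ V : M, ∀ X₂ ∈ S, X₂ 0 0 = X₁ 0 0 → X₂ 0 1 = X₁ 0 1 → X₂ ∈ line X₁ V) :
    S.ncard ≤ Nat.card K * ((fun X : M => (X 0 0, X 0 1)) '' S).ncard := by
  classical
  have hfin : S.Finite := S.toFinite
  rw [Set.ncard_eq_toFinset_card S hfin]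
  have himg : ((fun X : M => (X 0 0, X 0 1)) '' S).ncard =
      (hfin.toFinset.image (fun X : M => (X 0 0, X 0 1))).card := by
    rw [← Set.ncard_coe_finset, Finset.coe_image, Set.Finite.coe_toFinset]
  rw [himg]
  refine Finset.card_le_mul_card_image hfin.toFinset (Nat.card K) (fun p hp => ?_)
  obtain ⟨X₁, hX₁, rfl⟩ := Finset.mem_image.1 hp
  rw [Set.Finite.mem_toFinset] at hX₁
  obtain ⟨V, hV⟩ := hS X₁ hX₁
  calc (hfin.toFinset.filter (fun X => (X 0 0, X 0 1) = (X₁ 0 0, X₁ 0 1))).card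
      ≤ (line X₁ V).ncard := by
        rw [← Set.ncard_coe_finset]
        refine Set.ncard_le_ncard ?_ (Set.toFinite _)
        intro X hX
        simp only [Finset.coe_filter, Set.Finite.mem_toFinset, Set.mem_setOf_eq,
          Prod.mk.injEq] at hX
        exact hV X hX.1 hX.2.1 hX.2.2
    _ ≤ Nat.card K := ncard_line_le X₁ V

/-- Three distinct roots force a polynomial of degree `≤ 2` to vanish identically. [folklore] -/
theorem eq_zero_of_three_roots {α β γ t₁ t₂ t₃ : K} (h₁ : α * t₁ ^ 2 + β * t₁ + γ = 0)
    (h₂ : α * t₂ ^ 2 + β * t₂ + γ = 0) (h₃ : α * t₃ ^ 2 + β * t₃ + γ = 0) (h12 : t₁ ≠ t₂)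
    (h13 : t₁ ≠ t₃) (h23 : t₂ ≠ t₃) : α = 0 ∧ β = 0 ∧ γ = 0 := by
  have key : ∀ {s t : K}, s ≠ t → α * s ^ 2 + β * s + γ = 0 → α * t ^ 2 + β * t + γ = 0 →
      α * (s + t) + β = 0 := by
    intro s t hst es et
    have hsub : (s - t) * (α * (s + t) + β) = 0 := by linear_combination es - et
    rcases mul_eq_zero.1 hsub with h | h
    · exact absurd (sub_eq_zero.1 h) hst
    · exact h
  have k12 := key h12 h₁ h₂
  have k13 := key h13 h₁ h₃
  have hα' : α * (t₂ - t₃) = 0 := by linear_combination k12 - k13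
  have hα : α = 0 := by
    rcases mul_eq_zero.1 hα' with h | h
    · exact h
    · exact absurd (sub_eq_zero.1 h) h23
  have hβ : β = 0 := by rw [hα] at k12; linear_combination k12
  refine ⟨hα, hβ, ?_⟩
  rw [hα, hβ] at h₁
  linear_combination h₁

/-- **Point count: `|Z ∩ H| ≤ q (q + 1)` for every affine hyperplane `H = {tr (A X) = c}`, `A ≠ 0`,
of `M₂(𝔽_q)`** (first-row projection; see the section docstring).  The extremal value `q² + q` is
that of a hyperbolic (split) hyperplane section of the quadric. [folklore] -/
theorem ncard_Z_inter_hyperplane_le [Fintype K] [DecidableEq K] {A : M} (hA : A ≠ 0) (c : K) :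
    (Z ∩ hyperplane A c : Set M).ncard ≤ Fintype.card K * (Fintype.card K + 1) := by
  classical
  set S : Set M := Z ∩ hyperplane A c with hSdef
  set ρ : M → K × K := fun X => (X 0 0, X 0 1) with hρ
  have hq : Nat.card K = Fintype.card K := Nat.card_eq_fintype_card
  -- the two equations satisfied by the entries of `X ∈ S`
  have hdet : ∀ X ∈ S, X 0 0 * X 1 1 - X 0 1 * X 1 0 = 1 := fun X hX => by
    rw [← Matrix.det_fin_two]; exact hX.1
  have htr : ∀ X ∈ S, A 0 0 * X 0 0 + A 0 1 * X 1 0 + A 1 0 * X 0 1 + A 1 1 * X 1 1 = c :=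
    fun X hX => by rw [← trace_mul_eq]; exact hX.2
  by_cases hcol : A 0 1 = 0 ∧ A 1 1 = 0
  · -- case (ii): `tr (A X)` only depends on the first row
    obtain ⟨hb, hd⟩ := hcol
    have hu : A 0 0 ≠ 0 ∨ A 1 0 ≠ 0 := by
      by_contra hcon
      push Not at hcon
      apply hA
      ext i j
      fin_cases i <;> fin_cases j
      · exact hcon.1
      · exact hb
      · exact hcon.2
      · exact hd
    -- fibres: same first row ⇒ on the line of direction `(0 0; x y)`
    have hfib : ∀ X₁ ∈ S, ∃ V : M, ∀ X₂ ∈ S, X₂ 0 0 = X₁ 0 0 → X₂ 0 1 = X₁ 0 1 →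
        X₂ ∈ line X₁ V := by
      intro X₁ h₁
      refine ⟨_, fun X₂ h₂ h00 h01 => mem_line_of_sameRow h00 h01 (u₁ := -(X₁ 0 1))
        (u₂ := X₁ 0 0) ?_ ?_⟩
      · by_contra hcon
        push Not at hcon
        have e := hdet X₁ h₁
        rw [hcon.2, neg_eq_zero.1 hcon.1] at e
        simp at e
      · have e₁ := hdet X₁ h₁
        have e₂ := hdet X₂ h₂
        rw [h00, h01] at e₂
        linear_combination e₂ - e₁
    -- first rows: on the affine line `A₀₀ x + A₁₀ y = c`, at most `q` of them
    have himg : (ρ '' S).ncard ≤ Nat.card K := by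
      rcases Set.eq_empty_or_nonempty S with hS0 | ⟨X₀, hX₀⟩
      · rw [hS0, Set.image_empty, Set.ncard_empty]; exact Nat.zero_le _
      · have hsub : ρ '' S ⊆ Set.range (fun t : K =>
            (X₀ 0 0 + t * A 1 0, X₀ 0 1 - t * A 0 0)) := by
          rintro p ⟨X, hX, rfl⟩
          have e₀ := htr X₀ hX₀
          have e := htr X hX
          rw [hb, hd] at e₀ e
          obtain ⟨s, hs1, hs2⟩ := exists_eq_mul_of_lin hu
            (show A 0 0 * (X 0 0 - X₀ 0 0) + A 1 0 * (X 0 1 - X₀ 0 1) = 0 by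
              linear_combination e - e₀)
          refine ⟨s, ?_⟩
          show (X₀ 0 0 + s * A 1 0, X₀ 0 1 - s * A 0 0) = (X 0 0, X 0 1)
          rw [Prod.mk.injEq]
          exact ⟨by linear_combination -hs1, by linear_combination -hs2⟩
        refine (Set.ncard_le_ncard hsub (Set.toFinite _)).trans ?_
        rw [← Set.image_univ]
        exact (Set.ncard_image_le (Set.finite_univ)).trans (Set.ncard_univ K).le
    calc S.ncard ≤ Nat.card K * (ρ '' S).ncard := ncard_le_card_mul_ncard_image_row hfib
      _ ≤ Nat.card K * Nat.card K := Nat.mul_le_mul_left _ himg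
      _ ≤ Fintype.card K * (Fintype.card K + 1) := by
        rw [hq]; exact Nat.mul_le_mul_left _ (Nat.le_succ _)
  · -- case (i): `(A₀₁, A₁₁) ≠ 0`
    have hu : A 0 1 ≠ 0 ∨ A 1 1 ≠ 0 := by
      by_contra hcon; push Not at hcon; exact hcol hcon
    set S₁ : Set M := {X | X ∈ S ∧ A 0 1 * X 0 0 + A 1 1 * X 0 1 ≠ 0} with hS₁
    set S₂ : Set M := {X | X ∈ S ∧ A 0 1 * X 0 0 + A 1 1 * X 0 1 = 0} with hS₂
    have hsplit : S ⊆ S₁ ∪ S₂ := by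
      intro X hX
      by_cases h : A 0 1 * X 0 0 + A 1 1 * X 0 1 = 0
      · exact Or.inr ⟨hX, h⟩
      · exact Or.inl ⟨hX, h⟩
    -- S₁: the first-row map is injective, with values in `{Δ ≠ 0}`
    set T₀ : Set (K × K) := {p | A 0 1 * p.1 + A 1 1 * p.2 = 0} with hT₀
    have hT₀eq : T₀ = Set.range (fun t : K => (t * A 1 1, -(t * A 0 1))) := by
      ext p
      constructor
      · intro hp
        obtain ⟨s, hs1, hs2⟩ := exists_eq_mul_of_lin hu (show A 0 1 * p.1 + A 1 1 * p.2 = 0 from hp)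
        exact ⟨s, Prod.ext hs1.symm hs2.symm⟩
      · rintro ⟨t, rfl⟩
        show A 0 1 * (t * A 1 1) + A 1 1 * (-(t * A 0 1)) = 0
        ring
    have hT₀card : T₀.ncard = Nat.card K := by
      rw [hT₀eq, Set.ncard_range_of_injective]
      intro t t' htt
      simp only [Prod.mk.injEq, neg_inj] at htt
      rcases hu with h | h
      · exact mul_right_cancel₀ h htt.2
      · exact mul_right_cancel₀ h htt.1
    have hS₁card : S₁.ncard ≤ Nat.card K * Nat.card K - Nat.card K := by
      have h1 : S₁.ncard ≤ (T₀ᶜ).ncard := by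
        refine Set.ncard_le_ncard_of_injOn ρ (fun X hX => ?_) ?_ (Set.toFinite _)
        · exact hX.2
        · rintro X ⟨hX, hΔ⟩ X' ⟨hX', -⟩ hρXX'
          have h00 : X' 0 0 = X 0 0 := (congrArg Prod.fst hρXX').symm
          have h01 : X' 0 1 = X 0 1 := (congrArg Prod.snd hρXX').symm
          have e₁ := htr X hX
          have e₂ := htr X' hX'
          have d₁ := hdet X hX
          have d₂ := hdet X' hX'
          rw [h00, h01] at e₂ d₂
          have hz : (X' 1 0 - X 1 0) * (A 0 1 * X 0 0 + A 1 1 * X 0 1) = 0 := by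
            linear_combination X 0 0 * e₂ - X 0 0 * e₁ - A 1 1 * d₂ + A 1 1 * d₁
          have hw : (X' 1 1 - X 1 1) * (A 0 1 * X 0 0 + A 1 1 * X 0 1) = 0 := by
            linear_combination X 0 1 * e₂ - X 0 1 * e₁ + A 0 1 * d₂ - A 0 1 * d₁
          have hz' : X' 1 0 = X 1 0 :=
            sub_eq_zero.1 ((mul_eq_zero.1 hz).resolve_right hΔ)
          have hw' : X' 1 1 = X 1 1 :=
            sub_eq_zero.1 ((mul_eq_zero.1 hw).resolve_right hΔ)
          ext i j
          fin_cases i <;> fin_cases j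
          · exact h00.symm
          · exact h01.symm
          · exact hz'.symm
          · exact hw'.symm
      rw [Set.ncard_compl T₀ (Set.toFinite _) (Set.toFinite _), hT₀card, Nat.card_prod] at h1
      exact h1
    -- S₂: at most two first rows, at most `q` points over each
    have hfib : ∀ X₁ ∈ S₂, ∃ V : M, ∀ X₂ ∈ S₂, X₂ 0 0 = X₁ 0 0 → X₂ 0 1 = X₁ 0 1 →
        X₂ ∈ line X₁ V := by
      rintro X₁ ⟨h₁, -⟩
      refine ⟨_, fun X₂ h₂ h00 h01 => mem_line_of_sameRow h00 h01 hu ?_⟩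
      have e₁ := htr X₁ h₁
      have e₂ := htr X₂ h₂.1
      rw [h00, h01] at e₂
      linear_combination e₂ - e₁
    have himg : (ρ '' S₂).ncard ≤ 2 := by
      by_contra hcon
      obtain ⟨p₁, p₂, p₃, ⟨X₁, hX₁, rfl⟩, ⟨X₂, hX₂, rfl⟩, ⟨X₃, hX₃, rfl⟩, h12, h13, h23⟩ :=
        (Set.two_lt_ncard_iff).1 (not_le.1 hcon)
      -- parameters tᵢ of the first rows on the line `Δ = 0`, roots of a quadratic with constant 1
      have param : ∀ X ∈ S₂, ∃ t : K, X 0 0 = t * A 1 1 ∧ X 0 1 = -(t * A 0 1) ∧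
          (A 1 0 * A 0 1 - A 0 0 * A 1 1) * t ^ 2 + c * t + (-1) = 0 := by
        rintro X ⟨hX, hΔ⟩
        obtain ⟨t, ht1, ht2⟩ := exists_eq_mul_of_lin hu hΔ
        refine ⟨t, ht1, ht2, ?_⟩
        have e := htr X hX
        have d := hdet X hX
        linear_combination (-t) * e + (A 0 0 * t - X 1 1) * ht1 + (A 1 0 * t + X 1 0) * ht2 + d
      obtain ⟨t₁, a₁, b₁, r₁⟩ := param X₁ hX₁
      obtain ⟨t₂, a₂, b₂, r₂⟩ := param X₂ hX₂
      obtain ⟨t₃, a₃, b₃, r₃⟩ := param X₃ hX₃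
      have ne : ∀ {t t' : K} {X X' : M}, X 0 0 = t * A 1 1 → X 0 1 = -(t * A 0 1) →
          X' 0 0 = t' * A 1 1 → X' 0 1 = -(t' * A 0 1) → ρ X ≠ ρ X' → t ≠ t' := by
        intro t t' X X' a b a' b' hne htt
        apply hne
        show (X 0 0, X 0 1) = (X' 0 0, X' 0 1)
        rw [a, b, a', b', htt]
      obtain ⟨-, -, h1⟩ := eq_zero_of_three_roots r₁ r₂ r₃ (ne a₁ b₁ a₂ b₂ h12)
        (ne a₁ b₁ a₃ b₃ h13) (ne a₂ b₂ a₃ b₃ h23)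
      exact absurd h1 (by norm_num)
    have hS₂card : S₂.ncard ≤ Nat.card K * 2 :=
      (ncard_le_card_mul_ncard_image_row hfib).trans (Nat.mul_le_mul_left _ himg)
    -- total
    have hqpos : 1 ≤ Nat.card K := Nat.one_le_iff_ne_zero.2 Nat.card_pos.ne'
    calc S.ncard ≤ (S₁ ∪ S₂).ncard := Set.ncard_le_ncard hsplit (Set.toFinite _)
      _ ≤ S₁.ncard + S₂.ncard := Set.ncard_union_le S₁ S₂
      _ ≤ (Nat.card K * Nat.card K - Nat.card K) + Nat.card K * 2 := add_le_add hS₁card hS₂card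
      _ = Fintype.card K * (Fintype.card K + 1) := by
        rw [hq]
        have h := Nat.le_mul_self (Fintype.card K)
        generalize Fintype.card K = q at h ⊢
        generalize hm : q * q = m at h
        have e : q * (q + 1) = m + q := by rw [← hm]; ring
        omega

/-- **Sharp form of the `k = 3` bound: every affine hyperplane `{X : tr (A X) = c}` (`A ≠ 0`) of
`M₂(𝔽_q) ≅ 𝔽_q⁴` contains at most `2 (q + 1)` lines of `Z`** (`q ≥ 3`; from the incidence bound
`ncard_linesInZIn_mul_card_le` and the point count `ncard_Z_inter_hyperplane_le`).  `2 (q + 1)` is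
the number of lines on a hyperbolic quadric surface over `𝔽_q`, so the constant cannot be improved
(the equality cases are not formalized here).  Tao states `O(|F|)` (p. 342).
[cite: Tao2005FiniteFieldBesicovitch4D, Prop. 1.3, proof (§3, p. 342)] -/
theorem ncard_linesInZIn_hyperplane_le_sharp [Fintype K] [DecidableEq K] (hK : 2 < Fintype.card K)
    {A : M} (hA : A ≠ 0) (c : K) :
    (linesInZIn (hyperplane A c)).ncard ≤ 2 * (Fintype.card K + 1) := by
  have h3 : ∃ c : K, c ≠ 0 ∧ c ≠ 1 := two_lt_card_iff.1 hK
  have h1 := ncard_linesInZIn_mul_card_le h3 hA c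
  have h2 := ncard_Z_inter_hyperplane_le hA c
  rw [Nat.card_eq_fintype_card] at h1
  generalize hq : Fintype.card K = q at h1 h2 hK ⊢
  generalize (linesInZIn (hyperplane A c)).ncard = L at h1 ⊢
  generalize (Z ∩ hyperplane A c : Set M).ncard = n at h1 h2
  -- L q ≤ 2 n + q − 1 ≤ 2 q (q + 1) + q − 1 < q (2 q + 3)
  obtain ⟨p, rfl⟩ : ∃ p, q = p + 1 := ⟨q - 1, by omega⟩
  simp only [Nat.add_sub_cancel] at h1
  by_contra hcon
  push Not at hcon
  have e1 := Nat.mul_le_mul_right (p + 1) (Nat.succ_le_of_lt hcon)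
  have e2 := Nat.mul_le_mul_left 2 h2
  ring_nf at e1 e2 h1
  linarith [Nat.zero_le (p * L), Nat.zero_le (p ^ 2)]

/-- The sharp bound for parametrised affine subspaces `{P + r U + s V + t W}`, in particular for
every affine 3-space of `M₂(𝔽_q) ≅ 𝔽_q⁴`: at most `2 (q + 1)` lines of `Z` (`q ≥ 3`).
[cite: Tao2005FiniteFieldBesicovitch4D, Prop. 1.3, proof (§3, p. 342)] -/
theorem ncard_linesInZIn_space_le_sharp [Fintype K] [DecidableEq K] (hK : 2 < Fintype.card K)
    (P U V W : M) : (linesInZIn (space P U V W)).ncard ≤ 2 * (Fintype.card K + 1) := by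
  obtain ⟨A, hA, c, hsub⟩ := exists_hyperplane_of_space P U V W
  refine (Set.ncard_le_ncard ?_ (Set.toFinite _)).trans
    (ncard_linesInZIn_hyperplane_le_sharp hK hA c)
  rintro ℓ ⟨hℓ, hS⟩
  exact ⟨hℓ, hS.trans hsub⟩

end PointCount

/-! ## Directions: `(q + 1)²` null directions, `q − 1` parallel lines of `Z` in each

Tao (p. 338): "The proposition does not contradict the Kakeya conjecture because the lines `L` do
not all point in different directions"; §2 (p. 340): "Two lines are parallel if they are translates
of each other but not identical; a set of lines is said to point in different directions if no two
lines in the set are parallel or identical."  For the split form this is made quantitative: the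
direction (difference set, `dir`) of a line of `Z` is a null direction `K V`, `V ≠ 0`, `det V = 0`
(`det_direction_eq_zero`); conversely every null direction is the direction of exactly `q − 1` lines
of `Z` (`ncard_linesInZDir`), so the `(q − 1)(q + 1)²` lines of `Z` fall into `(q + 1)²` parallel
classes (`natCard_nullDirections`) — far from the `∼ q³` directions of a family pointing in
different directions — and there are exactly `(q − 1)(q + 1)²` nonzero null vectors
(`ncard_nullVectors`; Tao, p. 342: "`∼ |F|³` choices of null direction").  The proof transports
everything along the action `X ↦ g X h` of `SL₂(K) × SL₂(K)`, which preserves `Z`, lines and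
parallelism and is transitive on the nonzero singular matrices (`exists_sandwich_eq`), to the
single direction `E = (0 1; 0 0)`, whose parallel class consists of the `q − 1` lines
`{(a t; 0 a⁻¹) : t ∈ K}`, `a ∈ Kˣ` (`linesInZDir_E`). -/

section Directions

local notation "M" => Matrix (Fin 2) (Fin 2) K

/-- The *direction* of a point set `ℓ ⊆ M₂(K)`: its difference set `{X − Y : X, Y ∈ ℓ}`.  For a line
`line P V` this is the line `line 0 V = K V` through the origin (`dir_line`); two lines with nonzero
direction vectors have the same `dir` iff they are identical or parallel (`dir_eq_iff`).
[folklore] -/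
def dir (ℓ : Set M) : Set M := Set.image2 (fun X Y => X - Y) ℓ ℓ

/-- `dir (line P V) = line 0 V`. [folklore] -/
theorem dir_line (P V : M) : dir (line P V) = line 0 V := by
  ext X
  simp only [dir, line, Set.mem_image2, Set.mem_range, zero_add]
  constructor
  · rintro ⟨_, ⟨s, rfl⟩, _, ⟨t, rfl⟩, rfl⟩
    exact ⟨s - t, by rw [sub_smul]; abel⟩
  · rintro ⟨t, rfl⟩
    exact ⟨P + t • V, ⟨t, rfl⟩, P + (0 : K) • V, ⟨0, rfl⟩, by simp⟩

/-- Translating a line translates its base point: `line P V + W = line (P + W) V`. [folklore] -/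
theorem image_add_line (P V W : M) : (fun X => X + W) '' line P V = line (P + W) V := by
  ext X
  simp only [line, Set.mem_image, Set.mem_range]
  constructor
  · rintro ⟨_, ⟨t, rfl⟩, rfl⟩
    exact ⟨t, by abel⟩
  · rintro ⟨t, rfl⟩
    exact ⟨P + t • V, ⟨t, rfl⟩, by abel⟩

/-- If `line 0 V = line 0 W` and `W ≠ 0` then `W = c V` with `c ≠ 0`. [folklore] -/
theorem exists_smul_of_line_zero_eq {V W : M} (hW : W ≠ 0) (h : line 0 V = line 0 W) :
    ∃ c : K, c ≠ 0 ∧ W = c • V := by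
  obtain ⟨c, hc⟩ := exists_eq_smul_of_line_eq h
  refine ⟨c, ?_, hc⟩
  rintro rfl
  rw [zero_smul] at hc
  exact hW hc

/-- "Two lines are parallel if they are translates of each other but not identical" (Tao, §2,
p. 340; compare Mathlib's `AffineSubspace.Parallel`, which allows identical subspaces).
[cite: Tao2005FiniteFieldBesicovitch4D, §2 (p. 340)] -/
def IsParallel (ℓ₁ ℓ₂ : Set M) : Prop := ℓ₁ ≠ ℓ₂ ∧ ∃ W : M, ℓ₂ = (fun X => X + W) '' ℓ₁

/-- "A set of lines is said to point in different directions if no two lines in the set are parallel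
or identical" (Tao, §2, p. 340).  For a *set* of lines two distinct members are never identical, so
the condition is that no two members are parallel.
[cite: Tao2005FiniteFieldBesicovitch4D, §2 (p. 340)] -/
def PointInDifferentDirections (L : Set (Set M)) : Prop :=
  ∀ ℓ₁ ∈ L, ∀ ℓ₂ ∈ L, ¬ IsParallel ℓ₁ ℓ₂

/-- Two lines have the same direction iff they are identical or parallel (only `V₂ ≠ 0` is
needed: for `V₁ = 0 ≠ V₂` both sides fail). [folklore] -/
theorem dir_eq_iff {P₁ V₁ P₂ V₂ : M} (hV₂ : V₂ ≠ 0) :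
    dir (line P₁ V₁) = dir (line P₂ V₂) ↔
      line P₁ V₁ = line P₂ V₂ ∨ IsParallel (line P₁ V₁) (line P₂ V₂) := by
  rw [dir_line, dir_line]
  constructor
  · intro h
    obtain ⟨c, hc, hV₂c⟩ := exists_smul_of_line_zero_eq hV₂ h
    by_cases he : line P₁ V₁ = line P₂ V₂
    · exact Or.inl he
    · refine Or.inr ⟨he, P₂ - P₁, ?_⟩
      rw [image_add_line, hV₂c, line_smul _ _ hc]
      congr 1
      abel
  · rintro (he | ⟨-, W, hW⟩)
    · have hP₂ : P₂ ∈ line P₁ V₁ := by rw [he]; exact mem_line_self P₂ V₂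
      rw [line_eq_of_mem hP₂] at he
      obtain ⟨c, hc⟩ := exists_eq_smul_of_line_eq he
      have hc0 : c ≠ 0 := by rintro rfl; rw [zero_smul] at hc; exact hV₂ hc
      rw [hc, line_smul _ _ hc0]
    · rw [image_add_line] at hW
      have hmem : P₂ ∈ line (P₁ + W) V₁ := by rw [← hW]; exact mem_line_self _ _
      rw [line_eq_of_mem hmem] at hW
      obtain ⟨c, hc⟩ := exists_eq_smul_of_line_eq hW.symm
      have hc0 : c ≠ 0 := by rintro rfl; rw [zero_smul] at hc; exact hV₂ hc
      rw [hc, line_smul _ _ hc0]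

/-- `line P V ⊆ Z` forces `det V = 0` (`|K| ≥ 3`): `det_direction_eq_zero` for lines given as
point sets. [folklore] -/
theorem det_eq_zero_of_line_subset (h3 : ∃ c : K, c ≠ 0 ∧ c ≠ 1) {P V : M} (hZ : line P V ⊆ Z) :
    V.det = 0 := by
  obtain ⟨N, hN, rfl⟩ := exists_nilpotent_of_line_subset P V h3 (fun t => hZ ⟨t, rfl⟩)
  exact det_direction_eq_zero P N hN

/-! ### The action of `SL₂ × SL₂`

`X ↦ g X h` (`det g = det h = 1`) preserves `Z`, maps lines to lines and direction vectors `V` to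
`g V h`; it acts transitively on the nonzero singular matrices (`exists_sandwich_eq`: every such
`V` is `g E h` with `E = (0 1; 0 0)`), which reduces all counts to the single direction `E`. -/

/-- Two-sided multiplication `X ↦ g X h`. [folklore] -/
def sandwich (g h : M) : M → M := fun X => g * X * h

/-- `g⁻¹ (g X h) h⁻¹ = X` for `det g = det h = 1`. [folklore] -/
theorem sandwich_inv_sandwich {g h : M} (hg : g.det = 1) (hh : h.det = 1) (X : M) :
    sandwich g⁻¹ h⁻¹ (sandwich g h X) = X := by
  have hgu : IsUnit g.det := by rw [hg]; exact isUnit_one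
  have hhu : IsUnit h.det := by rw [hh]; exact isUnit_one
  show g⁻¹ * (g * X * h) * h⁻¹ = X
  rw [show g⁻¹ * (g * X * h) * h⁻¹ = (g⁻¹ * g) * X * (h * h⁻¹) by simp only [Matrix.mul_assoc],
    Matrix.nonsing_inv_mul g hgu, Matrix.mul_nonsing_inv h hhu, one_mul, mul_one]

/-- `g (g⁻¹ X h⁻¹) h = X` for `det g = det h = 1`. [folklore] -/
theorem sandwich_sandwich_inv {g h : M} (hg : g.det = 1) (hh : h.det = 1) (X : M) :
    sandwich g h (sandwich g⁻¹ h⁻¹ X) = X := by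
  have hgu : IsUnit g.det := by rw [hg]; exact isUnit_one
  have hhu : IsUnit h.det := by rw [hh]; exact isUnit_one
  show g * (g⁻¹ * X * h⁻¹) * h = X
  rw [show g * (g⁻¹ * X * h⁻¹) * h = (g * g⁻¹) * X * (h⁻¹ * h) by simp only [Matrix.mul_assoc],
    Matrix.mul_nonsing_inv g hgu, Matrix.nonsing_inv_mul h hhu, one_mul, mul_one]

/-- `det g⁻¹ = 1` when `det g = 1`. [folklore] -/
theorem det_inv_eq_one {g : M} (hg : g.det = 1) : g⁻¹.det = 1 := by
  rw [Matrix.det_nonsing_inv, hg, Ring.inverse_one]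

/-- `X ↦ g X h` is injective for `det g = det h = 1`. [folklore] -/
theorem sandwich_injective {g h : M} (hg : g.det = 1) (hh : h.det = 1) :
    Function.Injective (sandwich g h) := fun X Y hXY => by
  rw [← sandwich_inv_sandwich hg hh X, ← sandwich_inv_sandwich hg hh Y, hXY]

/-- `X ↦ g X h` maps `line P V` onto `line (g P h) (g V h)`. [folklore] -/
theorem image_sandwich_line (g h P V : M) :
    sandwich g h '' line P V = line (g * P * h) (g * V * h) := by
  ext X
  simp only [sandwich, line, Set.mem_image, Set.mem_range]
  constructor
  · rintro ⟨_, ⟨t, rfl⟩, rfl⟩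
    exact ⟨t, by simp only [Matrix.mul_add, Matrix.add_mul, Matrix.mul_smul, Matrix.smul_mul]⟩
  · rintro ⟨t, rfl⟩
    exact ⟨P + t • V, ⟨t, rfl⟩,
      by simp only [Matrix.mul_add, Matrix.add_mul, Matrix.mul_smul, Matrix.smul_mul]⟩

/-- `X ↦ g X h` preserves `Z` (`det g = det h = 1`). [folklore] -/
theorem sandwich_mem_Z_iff {g h : M} (hg : g.det = 1) (hh : h.det = 1) (X : M) :
    sandwich g h X ∈ Z ↔ X ∈ Z := by
  show (g * X * h).det = 1 ↔ X.det = 1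
  rw [Matrix.det_mul, Matrix.det_mul, hg, hh, one_mul, mul_one]

/-- A set lies in `Z` iff its image under `X ↦ g X h` does (`det g = det h = 1`). [folklore] -/
theorem image_sandwich_subset_Z_iff {g h : M} (hg : g.det = 1) (hh : h.det = 1) {S : Set M} :
    sandwich g h '' S ⊆ Z ↔ S ⊆ Z := by
  constructor
  · intro hS X hX
    exact (sandwich_mem_Z_iff hg hh X).1 (hS ⟨X, hX, rfl⟩)
  · rintro hS _ ⟨X, hX, rfl⟩
    exact (sandwich_mem_Z_iff hg hh X).2 (hS hX)

/-- `X ↦ g X h` maps lines of `Z` to lines of `Z` (`det g = det h = 1`). [folklore] -/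
theorem image_sandwich_mem_linesInZ {g h : M} (hg : g.det = 1) (hh : h.det = 1) {ℓ : Set M}
    (hℓ : ℓ ∈ linesInZ) : sandwich g h '' ℓ ∈ linesInZ := by
  obtain ⟨P, V, hV, rfl, hZ⟩ := hℓ
  refine ⟨g * P * h, g * V * h, ?_, image_sandwich_line g h P V, ?_⟩
  · intro h0
    apply hV
    apply sandwich_injective hg hh
    show g * V * h = g * 0 * h
    rw [h0, Matrix.mul_zero, Matrix.zero_mul]
  · exact (image_sandwich_subset_Z_iff hg hh).2 hZ

/-! ### Parallel classes -/

/-- The lines of `Z` with direction vector `V` (equivalently, for `V ≠ 0`, with `dir = line 0 V`,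
`linesInZDir_eq`): a parallel class of lines of `Z`. [folklore] -/
def linesInZDir (V : M) : Set (Set M) := {ℓ | ℓ ∈ linesInZ ∧ ∃ P : M, ℓ = line P V}

/-- For `V ≠ 0`, `linesInZDir V` is the set of lines of `Z` whose direction is `line 0 V`.
[folklore] -/
theorem linesInZDir_eq {V : M} (hV : V ≠ 0) :
    linesInZDir V = {ℓ | ℓ ∈ linesInZ ∧ dir ℓ = line 0 V} := by
  ext ℓ
  constructor
  · rintro ⟨hℓ, P, rfl⟩
    exact ⟨hℓ, dir_line P V⟩
  · rintro ⟨hℓ, hd⟩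
    refine ⟨hℓ, ?_⟩
    obtain ⟨P, W, hW, rfl, -⟩ := hℓ
    rw [dir_line] at hd
    obtain ⟨c, hc, hVc⟩ := exists_smul_of_line_zero_eq hV hd
    exact ⟨P, by rw [hVc, line_smul _ _ hc]⟩

/-- `X ↦ g X h` maps the class of `V` into the class of `g V h`. [folklore] -/
theorem image_sandwich_mem_linesInZDir {g h : M} (hg : g.det = 1) (hh : h.det = 1) {V : M}
    {ℓ : Set M} (hℓ : ℓ ∈ linesInZDir V) : sandwich g h '' ℓ ∈ linesInZDir (g * V * h) := by
  obtain ⟨hZ, P, rfl⟩ := hℓ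
  exact ⟨image_sandwich_mem_linesInZ hg hh hZ, g * P * h, image_sandwich_line g h P V⟩

/-- `X ↦ g X h` maps the class of `V` onto the class of `g V h`. [folklore] -/
theorem image_linesInZDir {g h : M} (hg : g.det = 1) (hh : h.det = 1) (V : M) :
    Set.image (sandwich g h) '' linesInZDir V = linesInZDir (g * V * h) := by
  ext ℓ'
  constructor
  · rintro ⟨ℓ, hℓ, rfl⟩
    exact image_sandwich_mem_linesInZDir hg hh hℓ
  · intro hℓ'
    refine ⟨sandwich g⁻¹ h⁻¹ '' ℓ', ?_, ?_⟩
    · have hmem := image_sandwich_mem_linesInZDir (det_inv_eq_one hg) (det_inv_eq_one hh) hℓ'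
      have e : g⁻¹ * (g * V * h) * h⁻¹ = V := sandwich_inv_sandwich hg hh V
      rwa [e] at hmem
    · rw [← Set.image_comp]
      conv_rhs => rw [← Set.image_id ℓ']
      refine Set.image_congr' (fun X => ?_)
      exact sandwich_sandwich_inv hg hh X

/-- Parallel classes related by the action have the same size. [folklore] -/
theorem ncard_linesInZDir_sandwich {g h : M} (hg : g.det = 1) (hh : h.det = 1) (V : M) :
    (linesInZDir (g * V * h)).ncard = (linesInZDir V).ncard := by
  rw [← image_linesInZDir hg hh V,
    Set.ncard_image_of_injective _ (Set.image_injective.2 (sandwich_injective hg hh))]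

/-! ### Normal form of a nonzero singular matrix under `SL₂ × SL₂` -/

/-- `(1 0; m 1) E h` has rows `(h₁₀, h₁₁)` and `m (h₁₀, h₁₁)`. [folklore] -/
theorem lower_mul_E_mul (m : K) (h : M) :
    !![1, 0; m, 1] * !![0, 1; 0, 0] * h = !![h 1 0, h 1 1; m * h 1 0, m * h 1 1] := by
  ext i j
  fin_cases i <;> fin_cases j <;> simp [Matrix.mul_apply, Fin.sum_univ_two]

/-- `(0 −1; 1 0) E h` has rows `0` and `(h₁₀, h₁₁)`. [folklore] -/
theorem rot_mul_E_mul (h : M) :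
    !![0, -1; 1, 0] * !![0, 1; 0, 0] * h = !![0, 0; h 1 0, h 1 1] := by
  ext i j
  fin_cases i <;> fin_cases j <;> simp [Matrix.mul_apply, Fin.sum_univ_two]

/-- **Normal form.** Every nonzero singular `2 × 2` matrix is `g E h` with `det g = det h = 1` and
`E = (0 1; 0 0)`: `SL₂(K) × SL₂(K)` acts transitively on the nonzero null vectors of the split form
(`V = u wᵀ` with `u` the first column of `g` and `wᵀ` the second row of `h`). [folklore] -/
theorem exists_sandwich_eq {V : M} (hV : V ≠ 0) (hdet : V.det = 0) :
    ∃ g h : M, g.det = 1 ∧ h.det = 1 ∧ V = g * !![0, 1; 0, 0] * h := by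
  rw [Matrix.det_fin_two] at hdet
  by_cases hp : V 0 0 = 0
  · by_cases hq : V 0 1 = 0
    · -- first row zero: `V = (0 0; r s)`
      by_cases hr : V 1 0 = 0
      · have hs : V 1 1 ≠ 0 := by
          intro hs
          apply hV
          ext i j
          fin_cases i <;> fin_cases j
          · exact hp
          · exact hq
          · exact hr
          · exact hs
        refine ⟨!![0, -1; 1, 0], !![(V 1 1)⁻¹, 0; 0, V 1 1], by simp [Matrix.det_fin_two],
          by simp [Matrix.det_fin_two, hs], ?_⟩
        rw [rot_mul_E_mul]
        ext i j
        fin_cases i <;> fin_cases j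
        · simp [hp]
        · simp [hq]
        · simp [hr]
        · simp
      · refine ⟨!![0, -1; 1, 0], !![0, -(V 1 0)⁻¹; V 1 0, V 1 1], by simp [Matrix.det_fin_two],
          by simp [Matrix.det_fin_two, hr], ?_⟩
        rw [rot_mul_E_mul]
        ext i j
        fin_cases i <;> fin_cases j
        · simp [hp]
        · simp [hq]
        · simp
        · simp
    · -- `p = 0`, `q ≠ 0`: then `r = 0` and `V = (0 q; 0 s)`
      have hr : V 1 0 = 0 := by
        have : V 0 1 * V 1 0 = 0 := by rw [hp, zero_mul, zero_sub, neg_eq_zero] at hdet; exact hdet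
        rcases mul_eq_zero.1 this with h' | h'
        · exact absurd h' hq
        · exact h'
      refine ⟨!![1, 0; V 1 1 / V 0 1, 1], !![(V 0 1)⁻¹, 0; 0, V 0 1], by simp [Matrix.det_fin_two],
        by simp [Matrix.det_fin_two, hq], ?_⟩
      rw [lower_mul_E_mul]
      ext i j
      fin_cases i <;> fin_cases j
      · simp [hp]
      · simp
      · simp [hr]
      · simp [div_mul_cancel₀ _ hq]
  · -- `p ≠ 0`: `V = (p q; r rq/p)`
    have hs : V 1 1 = V 1 0 * V 0 1 / V 0 0 := by
      field_simp
      linear_combination hdet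
    refine ⟨!![1, 0; V 1 0 / V 0 0, 1], !![0, -(V 0 0)⁻¹; V 0 0, V 0 1],
      by simp [Matrix.det_fin_two], by simp [Matrix.det_fin_two, hp], ?_⟩
    rw [lower_mul_E_mul]
    ext i j
    fin_cases i <;> fin_cases j
    · simp
    · simp
    · simp [div_mul_cancel₀ _ hp]
    · simp only [Fin.mk_one, Fin.isValue, Matrix.of_apply, Matrix.cons_val', Matrix.cons_val_one,
        Matrix.cons_val_fin_one, Matrix.empty_val', Matrix.cons_val_zero]
      rw [hs]
      ring

/-! ### The class of `E = (0 1; 0 0)`: the `q − 1` lines `{(a *; 0 a⁻¹)}` -/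

/-- The line `{(a t; 0 a⁻¹) : t}` lies in `Z` for `a ≠ 0`. [folklore] -/
theorem line_diag_E_subset_Z {a : K} (ha : a ≠ 0) :
    line (!![a, 0; 0, a⁻¹] : M) !![0, 1; 0, 0] ⊆ Z := by
  rintro X ⟨t, rfl⟩
  show Matrix.det (!![a, 0; 0, a⁻¹] + t • !![0, 1; 0, 0]) = 1
  simp [Matrix.det_fin_two, ha]

/-- `E = (0 1; 0 0)` is nonzero. [folklore] -/
theorem e01_ne_zero : (!![0, 1; 0, 0] : M) ≠ 0 := by
  intro h
  have := congrFun (congrFun h 0) 1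
  simp at this

/-- **The parallel class of `E`:** the lines of `Z` with direction vector `E = (0 1; 0 0)` are
exactly the `line (a 0; 0 a⁻¹) E = {(a t; 0 a⁻¹) : t ∈ K}`, `a ∈ Kˣ` (the cosets of the unipotent
radical in the Borel subgroup of `SL₂(K)`). [folklore] -/
theorem linesInZDir_E :
    linesInZDir (!![0, 1; 0, 0] : M) =
      Set.range (fun a : Kˣ => line (!![(a : K), 0; 0, (a : K)⁻¹] : M) !![0, 1; 0, 0]) := by
  ext ℓ
  constructor
  · rintro ⟨hℓ, P, rfl⟩
    obtain ⟨-, -, -, -, hZ⟩ := hℓ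
    have h0 : P.det = 1 := hZ (mem_line_self _ _)
    have h1 : (P + (1 : K) • !![0, 1; 0, 0]).det = 1 := hZ ⟨1, rfl⟩
    rw [Matrix.det_fin_two] at h0 h1
    simp only [one_smul, Matrix.add_apply, Matrix.of_apply, Matrix.cons_val', Matrix.cons_val_zero,
      Matrix.cons_val_one, Matrix.cons_val_fin_one, Matrix.empty_val', add_zero] at h1
    have hP10 : P 1 0 = 0 := by linear_combination h0 - h1
    have hP : P 0 0 * P 1 1 = 1 := by rw [hP10, mul_zero, sub_zero] at h0; exact h0
    have ha : P 0 0 ≠ 0 := by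
      intro ha0
      rw [ha0, zero_mul] at hP
      exact zero_ne_one hP
    have hP11 : P 1 1 = (P 0 0)⁻¹ := eq_inv_of_mul_eq_one_right hP
    refine ⟨Units.mk0 (P 0 0) ha, ?_⟩
    have hmem : (!![P 0 0, 0; 0, (P 0 0)⁻¹] : M) ∈ line P !![0, 1; 0, 0] := by
      refine ⟨-(P 0 1), ?_⟩
      ext i j
      fin_cases i <;> fin_cases j
      · simp
      · simp
      · simp [hP10]
      · simp [hP11]
    exact (line_eq_of_mem hmem).symm
  · rintro ⟨a, rfl⟩
    exact ⟨⟨_, _, e01_ne_zero, rfl, line_diag_E_subset_Z a.ne_zero⟩, _, rfl⟩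

/-- Distinct `a ∈ Kˣ` give distinct lines `line (a 0; 0 a⁻¹) E`. [folklore] -/
theorem line_diag_E_injective :
    Function.Injective (fun a : Kˣ => line (!![(a : K), 0; 0, (a : K)⁻¹] : M) !![0, 1; 0, 0]) := by
  intro a b hab
  have hmem : (!![(b : K), 0; 0, (b : K)⁻¹] : M) ∈
      line (!![(a : K), 0; 0, (a : K)⁻¹] : M) !![0, 1; 0, 0] := by
    have h := mem_line_self (!![(b : K), 0; 0, (b : K)⁻¹] : M) !![0, 1; 0, 0]
    beta_reduce at hab
    rw [← hab] at h
    exact h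
  obtain ⟨t, ht⟩ := hmem
  have h00 := congrFun (congrFun ht 0) 0
  simp at h00
  exact Units.ext h00

/-- The parallel class of `E` has exactly `|K| − 1` members. [folklore] -/
theorem ncard_linesInZDir_E : (linesInZDir (!![0, 1; 0, 0] : M)).ncard = Nat.card K - 1 := by
  rw [linesInZDir_E, Set.ncard_range_of_injective line_diag_E_injective, Nat.card_units]

/-- **Every nonzero null vector `V` (`det V = 0`) is the direction vector of exactly `q − 1` lines
of `Z = SL₂(𝔽_q)`**, which are mutually parallel (any field; for infinite `K` both sides read `0`).
[cite: Tao2005FiniteFieldBesicovitch4D, remark after Prop. 1.3 (§1, p. 338): "the lines `L` do not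
all point in different directions"] -/
theorem ncard_linesInZDir {V : M} (hV : V ≠ 0) (hdet : V.det = 0) :
    (linesInZDir V).ncard = Nat.card K - 1 := by
  obtain ⟨g, h, hg, hh, rfl⟩ := exists_sandwich_eq hV hdet
  rw [ncard_linesInZDir_sandwich hg hh, ncard_linesInZDir_E]

/-- Every nonzero null vector is the direction of some line of `Z` (any field). [folklore] -/
theorem exists_mem_linesInZDir {V : M} (hV : V ≠ 0) (hdet : V.det = 0) :
    ∃ ℓ : Set M, ℓ ∈ linesInZDir V := by
  obtain ⟨g, h, hg, hh, rfl⟩ := exists_sandwich_eq hV hdet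
  refine ⟨sandwich g h '' line (!![((1 : Kˣ) : K), 0; 0, ((1 : Kˣ) : K)⁻¹] : M) !![0, 1; 0, 0],
    image_sandwich_mem_linesInZDir hg hh ⟨?_, _, rfl⟩⟩
  exact ⟨_, _, e01_ne_zero, rfl, line_diag_E_subset_Z (1 : Kˣ).ne_zero⟩

/-- **The parallel class of a line of `Z` inside `linesInZ` has exactly `q − 1` members** (the line
itself included; `|K| ≥ 3`): every line of `Z = SL₂(𝔽_q)` is parallel to exactly `q − 2 ≥ 1` other
lines of `Z`. [cite: Tao2005FiniteFieldBesicovitch4D, remark after Prop. 1.3 (§1, p. 338)] -/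
theorem ncard_parallelClass (h3 : ∃ c : K, c ≠ 0 ∧ c ≠ 1) {ℓ : Set M} (hℓ : ℓ ∈ linesInZ) :
    {ℓ' | ℓ' ∈ linesInZ ∧ (ℓ' = ℓ ∨ IsParallel ℓ' ℓ)}.ncard = Nat.card K - 1 := by
  obtain ⟨P, V, hV, rfl, hZ⟩ := hℓ
  have hdet : V.det = 0 := det_eq_zero_of_line_subset h3 hZ
  have hset :
      {ℓ' | ℓ' ∈ linesInZ ∧ (ℓ' = line P V ∨ IsParallel ℓ' (line P V))} = linesInZDir V := by
    rw [linesInZDir_eq hV]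
    ext ℓ'
    simp only [Set.mem_setOf_eq]
    constructor
    · rintro ⟨hℓ', h⟩
      refine ⟨hℓ', ?_⟩
      obtain ⟨P', V', hV', rfl, -⟩ := hℓ'
      rw [← dir_line P V]
      exact (dir_eq_iff hV).2 h
    · rintro ⟨hℓ', hd⟩
      refine ⟨hℓ', ?_⟩
      obtain ⟨P', V', hV', rfl, -⟩ := hℓ'
      rw [← dir_line P V] at hd
      exact (dir_eq_iff hV).1 hd
  rw [hset, ncard_linesInZDir hV hdet]

/-- **"The lines `L` do not all point in different directions"** (Tao, p. 338, with the definitions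
of §2, p. 340), for the split form over any field with at least three elements: the lines
`{(1 t; 0 1)}` and `{(c t; 0 c⁻¹)}`, `c ≠ 0, 1`, of `Z` are parallel.
[cite: Tao2005FiniteFieldBesicovitch4D, remark after Prop. 1.3 (§1, p. 338)] -/
theorem not_pointInDifferentDirections (h3 : ∃ c : K, c ≠ 0 ∧ c ≠ 1) :
    ¬ PointInDifferentDirections (linesInZ : Set (Set M)) := by
  obtain ⟨c, hc0, hc1⟩ := h3
  intro h
  have mem : ∀ a : Kˣ, line (!![(a : K), 0; 0, (a : K)⁻¹] : M) !![0, 1; 0, 0] ∈ linesInZ :=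
    fun a => ⟨_, _, e01_ne_zero, rfl, line_diag_E_subset_Z a.ne_zero⟩
  refine h _ (mem 1) _ (mem (Units.mk0 c hc0)) ⟨fun heq => hc1 ?_, ?_⟩
  · have := line_diag_E_injective heq
    -- this : 1 = Units.mk0 c hc0
    have h' := congrArg (fun u : Kˣ => (u : K)) this
    simpa using h'.symm
  · refine ⟨!![((Units.mk0 c hc0 : Kˣ) : K), 0; 0, ((Units.mk0 c hc0 : Kˣ) : K)⁻¹] -
      !![((1 : Kˣ) : K), 0; 0, ((1 : Kˣ) : K)⁻¹], ?_⟩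
    rw [image_add_line, add_sub_cancel]

/-! ### The set of directions: all `(q + 1)²` null directions occur -/

/-- The null directions of the split form: the lines `K V` through the origin spanned by nonzero
singular matrices `V`. [folklore] -/
def nullDirections : Set (Set M) := {D | ∃ V : M, V ≠ 0 ∧ V.det = 0 ∧ D = line 0 V}

/-- Directions of lines of `Z` are null (`|K| ≥ 3`). [folklore] -/
theorem dir_mem_nullDirections (h3 : ∃ c : K, c ≠ 0 ∧ c ≠ 1) {ℓ : Set M} (hℓ : ℓ ∈ linesInZ) :
    dir ℓ ∈ nullDirections := by
  obtain ⟨P, V, hV, rfl, hZ⟩ := hℓ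
  exact ⟨V, hV, det_eq_zero_of_line_subset h3 hZ, dir_line P V⟩

/-- **The directions of the lines of `Z` are exactly the null directions** (`|K| ≥ 3`): every
line of `Z` has a null direction (`det_direction_eq_zero`), and conversely every nonzero `V` with
`det V = 0` is the direction of a line (indeed of `q − 1` lines, `ncard_linesInZDir`) of `Z`.
[cite: Tao2005FiniteFieldBesicovitch4D, Prop. 1.3, proof (§3, p. 342): the lines of `L` are
generated by the pairs `(x, v)`, `v` a "null direction"] -/
theorem dir_image_linesInZ (h3 : ∃ c : K, c ≠ 0 ∧ c ≠ 1) :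
    dir '' (linesInZ : Set (Set M)) = nullDirections := by
  ext D
  constructor
  · rintro ⟨ℓ, hℓ, rfl⟩
    exact dir_mem_nullDirections h3 hℓ
  · rintro ⟨V, hV, hdet, rfl⟩
    obtain ⟨ℓ, hℓZ, P, rfl⟩ := exists_mem_linesInZDir hV hdet
    exact ⟨line P V, hℓZ, dir_line P V⟩

/-- **Direction count: the `(q − 1)(q + 1)²` lines of `Z = SL₂(𝔽_q)` occupy exactly `(q + 1)²`
directions** (`q ≥ 3`), each null direction carrying `q − 1` parallel lines (`ncard_linesInZDir`);
a family of lines pointing in different directions with this many members would need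
`(q − 1)(q + 1)² ∼ q³` directions.
[cite: Tao2005FiniteFieldBesicovitch4D, remark after Prop. 1.3 (§1, p. 338)] -/
theorem natCard_nullDirections [Fintype K] [DecidableEq K] (hK : 2 < Fintype.card K) :
    Nat.card (nullDirections : Set (Set M)) = (Fintype.card K + 1) ^ 2 := by
  classical
  have h3 : ∃ c : K, c ≠ 0 ∧ c ≠ 1 := two_lt_card_iff.1 hK
  haveI : Fintype (nullDirections : Set (Set M)) := Fintype.ofFinite _
  let f : ↥(linesInZ : Set (Set M)) → ↥(nullDirections : Set (Set M)) :=
    fun ℓ => ⟨dir ℓ.1, dir_mem_nullDirections h3 ℓ.2⟩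
  have hfib : ∀ D : ↥(nullDirections : Set (Set M)),
      Nat.card {ℓ // f ℓ = D} = Fintype.card K - 1 := by
    rintro ⟨D, hD⟩
    obtain ⟨V, hV, hdet, rfl⟩ := hD
    have e : {ℓ : ↥(linesInZ : Set (Set M)) // f ℓ = ⟨line 0 V, V, hV, hdet, rfl⟩} ≃
        ↥(linesInZDir V : Set (Set M)) :=
      { toFun := fun x => ⟨x.1.1, by
          rw [linesInZDir_eq hV]
          exact ⟨x.1.2, congrArg Subtype.val x.2⟩⟩
        invFun := fun y => ⟨⟨y.1, y.2.1⟩, Subtype.ext (by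
          have hy : (y.1 : Set M) ∈ {ℓ | ℓ ∈ linesInZ ∧ dir ℓ = line 0 V} := by
            rw [← linesInZDir_eq hV]; exact y.2
          exact hy.2)⟩
        left_inv := fun _ => rfl
        right_inv := fun _ => rfl }
    rw [Nat.card_congr e, Nat.card_coe_set_eq, ncard_linesInZDir hV hdet, Nat.card_eq_fintype_card]
  have htot : Nat.card (linesInZ : Set (Set M)) =
      Nat.card (nullDirections : Set (Set M)) * (Fintype.card K - 1) := by
    rw [← Nat.card_congr (Equiv.sigmaFiberEquiv f), Nat.card_sigma]
    simp only [hfib, Finset.sum_const, Finset.card_univ, smul_eq_mul, Nat.card_eq_fintype_card]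
  rw [natCard_linesInZ' h3] at htot
  have hq : 0 < Fintype.card K - 1 := by omega
  -- (q - 1) (q + 1)² = N (q - 1)
  rw [mul_comm] at htot
  exact (Nat.eq_of_mul_eq_mul_right hq htot).symm

/-! ### Null vectors: exactly `(q − 1)(q + 1)²` of them -/

/-- Each null direction `line 0 V` (`V ≠ 0`) contains exactly the `q − 1` nonzero multiples of `V`
as its nonzero null vectors. [folklore] -/
theorem ncard_nullVectors_of_dir {V : M} (hV : V ≠ 0) :
    {W : M | W ≠ 0 ∧ line 0 W = line 0 V}.ncard = Nat.card K - 1 := by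
  have hset : {W : M | W ≠ 0 ∧ line 0 W = line 0 V} = Set.range (fun c : Kˣ => (c : K) • V) := by
    ext W
    constructor
    · rintro ⟨hW, hWV⟩
      obtain ⟨c, hc, rfl⟩ := exists_smul_of_line_zero_eq hW hWV.symm
      exact ⟨Units.mk0 c hc, rfl⟩
    · rintro ⟨c, rfl⟩
      refine ⟨smul_ne_zero c.ne_zero hV, ?_⟩
      exact line_smul _ _ c.ne_zero
  rw [hset, Set.ncard_range_of_injective, Nat.card_units]
  intro c d hcd
  have h := sub_eq_zero.2 hcd
  beta_reduce at h
  rw [← sub_smul, smul_eq_zero] at h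
  rcases h with h | h
  · exact Units.ext (sub_eq_zero.1 h)
  · exact absurd h hV

/-- **Null vector count: exactly `(q − 1)(q + 1)²` nonzero `V ∈ M₂(𝔽_q)` with `det V = 0`**
(`q ≥ 3`) — Tao's "`∼ |F|³` choices of null direction `{v ∈ F⁴ ∖ 0 : ⟨v, v⟩ = 0}`" (proof of
Prop. 1.3, p. 342) with the exact constant: `(q + 1)²` null directions with `q − 1` nonzero vectors
on each.
[cite: Tao2005FiniteFieldBesicovitch4D, Prop. 1.3, proof (§3, p. 342)] -/
theorem ncard_nullVectors [Fintype K] [DecidableEq K] (hK : 2 < Fintype.card K) :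
    {V : M | V ≠ 0 ∧ V.det = 0}.ncard = (Fintype.card K - 1) * (Fintype.card K + 1) ^ 2 := by
  classical
  haveI : Fintype (nullDirections : Set (Set M)) := Fintype.ofFinite _
  set NV : Set M := {V : M | V ≠ 0 ∧ V.det = 0} with hNV
  let f : ↥(NV : Set M) → ↥(nullDirections : Set (Set M)) :=
    fun V => ⟨line 0 V.1, V.1, V.2.1, V.2.2, rfl⟩
  have hfib : ∀ D : ↥(nullDirections : Set (Set M)),
      Nat.card {V // f V = D} = Fintype.card K - 1 := by
    rintro ⟨D, hD⟩
    obtain ⟨V, hV, hdet, rfl⟩ := hD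
    have e : {W : ↥(NV : Set M) // f W = ⟨line 0 V, V, hV, hdet, rfl⟩} ≃
        ↥({W : M | W ≠ 0 ∧ line 0 W = line 0 V} : Set M) :=
      { toFun := fun x => ⟨x.1.1, x.1.2.1, congrArg Subtype.val x.2⟩
        invFun := fun y => ⟨⟨y.1, y.2.1, by
          obtain ⟨c, hc, hyc⟩ := exists_smul_of_line_zero_eq y.2.1 y.2.2.symm
          rw [hyc, Matrix.det_smul, hdet, mul_zero]⟩, Subtype.ext y.2.2⟩
        left_inv := fun _ => rfl
        right_inv := fun _ => rfl }
    rw [Nat.card_congr e, Nat.card_coe_set_eq, ncard_nullVectors_of_dir hV,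
      Nat.card_eq_fintype_card]
  have htot : Nat.card (NV : Set M) =
      Nat.card (nullDirections : Set (Set M)) * (Fintype.card K - 1) := by
    rw [← Nat.card_congr (Equiv.sigmaFiberEquiv f), Nat.card_sigma]
    simp only [hfib, Finset.sum_const, Finset.card_univ, smul_eq_mul, Nat.card_eq_fintype_card]
  rw [← Nat.card_coe_set_eq, htot, natCard_nullDirections hK, mul_comm]

/-- **The direction structure of Tao's example (split form), assembled** (`q ≥ 3`): the lines of
`Z = SL₂(𝔽_q)` do not point in different directions; their directions are exactly the `(q + 1)²`
null directions of the form, each of which is the direction of exactly `q − 1` (parallel) lines of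
`Z`; and there are exactly `(q − 1)(q + 1)²` nonzero null vectors.
[cite: Tao2005FiniteFieldBesicovitch4D, remark after Prop. 1.3 (§1, p. 338), proof (§3, p. 342)] -/
theorem directions_split [Fintype K] [DecidableEq K] (hK : 2 < Fintype.card K) :
    ¬ PointInDifferentDirections (linesInZ : Set (Set M)) ∧
      dir '' (linesInZ : Set (Set M)) = nullDirections ∧
      Nat.card (nullDirections : Set (Set M)) = (Fintype.card K + 1) ^ 2 ∧
      (∀ V : M, V ≠ 0 → V.det = 0 → (linesInZDir V).ncard = Fintype.card K - 1) ∧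
      {V : M | V ≠ 0 ∧ V.det = 0}.ncard = (Fintype.card K - 1) * (Fintype.card K + 1) ^ 2 := by
  have h3 : ∃ c : K, c ≠ 0 ∧ c ≠ 1 := two_lt_card_iff.1 hK
  refine ⟨not_pointInDifferentDirections h3, dir_image_linesInZ h3, natCard_nullDirections hK,
    fun V hV hdet => ?_, ncard_nullVectors hK⟩
  rw [ncard_linesInZDir hV hdet, Nat.card_eq_fintype_card]

end Directions

/-!
## The example is nowhere plany

Łaba–Rai Choudhuri–Zahl (Res. Math. Sci. 13 (2026), §2) recall this example as the reason why
Wolff-type hypotheses alone give nothing better than `|⋃ L| ∼ q³` in `𝔽_q⁴` ("The example in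
[tao4d, Proposition 1.3] yields a family of lines in `𝔽_q⁴` such that `|ℒ| ≂ q³` and `ℒ` obeys the
Wolff axioms, but `|⋃_{l ∈ ℒ} l| ≂ q³`. To prove better bounds in 4 dimensions, we must either use
the property that all lines point in different directions, or else we must make additional
assumptions"), and prove the planebrush bound `|⋃ ℒ| ≳ |ℒ| q^{1/3}` under the additional
assumption that `ℒ` is *plany*: all lines of `ℒ` through any point of `⋃ ℒ` lie in a common
`2`-plane (their Definition 2.2 and Theorem 2.4, formalized in
`Literature.Combinatorics.Kakeya.FiniteFieldPlanebrush`).  The family `L` of this file is as far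
from plany as possible: at NO point of `Z` do the lines of `L` through it lie in a common `2`-plane.
-/

section Planiness

local notation "M" => Matrix (Fin 2) (Fin 2) K

/-- **Tao's family is nowhere plany:** for every point `g ∈ Z` and every affine `2`-plane
`{P + sU + tV}`, some line of `Z` through `g` is not contained in the plane — through `g` pass
`q + 1 ≥ 3` lines of `Z` (`ncard_linesThrough`), and no `2`-plane contains three
(`no_three_lines_in_plane`).  Hence the hypothesis "plany" of the planebrush theorem
(Łaba–Rai Choudhuri–Zahl 2026, Def. 2.2 / Thm. 2.4) fails for `L` at every point. [folklore] -/
theorem exists_linesThrough_not_subset_plane [Finite K] (h3 : ∃ c : K, c ≠ 0 ∧ c ≠ 1) {g : M}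
    (hg : g ∈ Z) (P U V : M) : ∃ ℓ ∈ linesThrough g, ¬ ℓ ⊆ plane P U V := by
  by_contra! hall
  have hcard : 2 < (linesThrough g).ncard := by
    rw [ncard_linesThrough (det_eq_one_of_mem_Z hg) h3]
    have h1 : 1 < Nat.card K := Finite.one_lt_card
    omega
  obtain ⟨ℓ₁, ℓ₂, ℓ₃, h₁, h₂, h₃, h12, h13, h23⟩ :=
    (Set.two_lt_ncard_iff (Set.toFinite _)).1 hcard
  rcases no_three_lines_in_plane h3 (mem_linesInZ_of_mem_linesThrough h₁)
      (mem_linesInZ_of_mem_linesThrough h₂) (mem_linesInZ_of_mem_linesThrough h₃)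
      (hall ℓ₁ h₁) (hall ℓ₂ h₂) (hall ℓ₃ h₃) h12 with h | h
  · exact h13 h.symm
  · exact h23 h.symm

/-- The same for finite `K` with `2 < |K|`, the form used by `prop3_split`. [folklore] -/
theorem nowhere_plany [Fintype K] (hK : 2 < Fintype.card K) {g : M} (hg : g ∈ Z)
    (P U V : M) : ∃ ℓ ∈ linesThrough g, ¬ ℓ ⊆ plane P U V :=
  exists_linesThrough_not_subset_plane (two_lt_card_iff.1 hK) hg P U V

end Planiness

end Tao2005Quadric

end Literature.Combinatorics.Kakeya
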